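import Literature.NumberTheory.Sieve.RosserSieveInductionStep
import Literature.NumberTheory.Sieve.RosserSieveMajorantPackage
import HarnessLib

/-!
# Rosser's sieve: the induction for the main term (Iwaniec's Lemma 20, qualitative form, `β > 1`)

Topic `Literature/NumberTheory/Sieve`; Iwaniec, *Rosser's sieve*, Acta Arith. 36 (1980), §8, Lemma 20:
"`T^±_{R,z}(s) < V(z) s^{−κ} {T^±_R(s) + G^±_z(s) (log y)^{−1/3}}` for `s > β − (1 ± 1)/2`", proved by
induction on `R` from the recurrences (4.3)–(4.6), (7.3) and Lemma 21. This file PROVES an abstract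
version of this induction for a sieve parameter `β > 1` (the case `κ > 1/2`): the analytic inputs enter
only through a *majorant package* `H^±` (hypotheses `hH1`–`hH6`; supplied for Iwaniec's data by
`RosserSieveMajorantPackage.exists_majorant_package`) and the crude bound at the truncation level
`z₀ = e^{√(log y)}` (`hcrude`; supplied by `RosserSieveInductionStep.discT_exp_sqrt_le`).

Our route differs from the printed one in the bookkeeping (variant recorded in the session notes): the
error term of the inductive bound at step `N` is `A_N C H^±(s) (log y)^{−e}` with a loss exponent
`0 ≤ e < 1/2` and amplitudes `A_N = 4N(1 + ε)^{2N}` (Iwaniec keeps the amplitude bounded by a saving in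
the majorant recursion and the factor `(1 + s^{50}/log y)^s`; we let it grow geometrically and truncate
`N` at `O(log log y)` afterwards, `RosserSieveMainTermBound`), the sifting range is decomposed at
`z₀ = e^{√(log y)}` where Rankin's trick applies, and only levels with `√(log y) ≤ log z` are considered
(this region is stable under `(y, z) ↦ (y/p, p)`, `z₀ ≤ p < z`).

## Contents (all PROVED; no definitions)

* `contT_zero_sub_eq_integral`, `contT_one_sub_eq_integral` ((7.3) between two points), elementary
  `rpow` facts, `discT_le_inv_vprod` (`∑_n T_n ≤ V^{−1}`), `level_facts`, `vprod_exp_sqrt_le`;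
* `step_zero` — the lower-parity step `N + 1 ↦ N + 2` (amplitude `a ↦ 2 + (1 + ε)a`): decomposition at
  `z₀` (`discT_zero_succ_succ_sub`), the inductive bound at `(y/p, p)`, Lemma 21 (`sum_peeled_le`),
  `∫_s^{s₀} k T⁺_{N+1}(· − 1) = T⁻_{N+2}(s) − T⁻_{N+2}(s₀)`, and the package bounds;
* `step_one_high` — the same for the upper parity in the range `z^{β+1} ≤ y`;
* `step_one_low` — the range `z^{β−1} < y < z^{β+1}` from (4.6) (`discT_one_eq_add`), (8.3)
  (`bdrySum_one_one_le`) and the third line of (7.3) (`contT_one_eq_of_le`), amplitude `a ↦ 1 + (1 + ε)a`;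
* `small_level` — levels `y < y₀` (compactness: `∑_n T_n ≤ V^{−1} ≤ M₁ ≤ M₁² V`);
* `claims_all` — the two-step induction on `N` assembling the above (bases `discT_zero_right'`,
  `discT_zero_one`, `discT_one_one_eq_zero`; `amp_facts`, `bound_mono`).

## References

* H. Iwaniec, *Rosser's sieve*, Acta Arith. 36 (1980), 171–202: §8, Lemma 20, (8.1)–(8.9); (4.6), (7.3).
  [IwaniecActaArith1980]
* G. Greaves, *Sieves in Number Theory*, Springer (2001), §4.4.3, Lemma 4 (the analogous induction for a
  composite sieve). [Greaves2001]
-/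

open Finset Filter Set MeasureTheory intervalIntegral
open scoped Topology

noncomputable section

namespace Literature.NumberTheory.Sieve

namespace BetaSieve

open BetaSieveForward (sieveKernel sieveKernel_nonneg continuousOn_sieveKernel)

variable {κ β : ℝ}

/-! ### Differences of the continuous models over `[s, s₀]` ((7.3) between two points) -/

/-- `T⁻_{N+2}(s) − T⁻_{N+2}(s₀) = ∫_s^{s₀} k(t) T⁺_{N+1}(t − 1) dt` for `β ≤ s ≤ s₀` (`β > 1`).
[cite: IwaniecActaArith1980, §7 (7.3)] -/
theorem contT_zero_sub_eq_integral (hκ : 0 ≤ κ) (hβ : 1 < β) (N : ℕ) {s s₀ : ℝ} (hs : β ≤ s)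
    (hss₀ : s ≤ s₀) :
    contT 0 κ β (N + 2) s - contT 0 κ β (N + 2) s₀ =
      ∫ t in s..s₀, sieveKernel κ t * contT 1 κ β (N + 1) (t - 1) := by
  set U := max s₀ (β + (N + 1 : ℕ) + 1) with hU
  have h1 := contT_zero_succ_eq_integral hκ hβ (N + 1) hs
    (show max s (β + (N + 1 : ℕ) + 1) ≤ U from max_le (hss₀.trans (le_max_left _ _)) (le_max_right _ _))
  have h2 := contT_zero_succ_eq_integral hκ hβ (N + 1) (hs.trans hss₀) (le_refl U)
  rw [h1, h2]
  have hs1 : 1 < s := by linarith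
  rw [← intervalIntegral.integral_add_adjacent_intervals
    (intervalIntegrable_sieveKernel_mul (κ := κ) (continuous_contT hκ hβ 1 (N + 1)) hs1 hss₀)
    (intervalIntegrable_sieveKernel_mul (κ := κ) (continuous_contT hκ hβ 1 (N + 1)) (by linarith)
      (le_max_left s₀ _))]
  ring

/-- `T⁺_{N+2}(s) − T⁺_{N+2}(s₀) = ∫_s^{s₀} k(t) T⁻_{N+1}(t − 1) dt` for `β + 1 ≤ s ≤ s₀` (`β > 1`).
[cite: IwaniecActaArith1980, §7 (7.3)] -/
theorem contT_one_sub_eq_integral (hκ : 0 ≤ κ) (hβ : 1 < β) (N : ℕ) {s s₀ : ℝ} (hs : β + 1 ≤ s)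
    (hss₀ : s ≤ s₀) :
    contT 1 κ β (N + 2) s - contT 1 κ β (N + 2) s₀ =
      ∫ t in s..s₀, sieveKernel κ t * contT 0 κ β (N + 1) (t - 1) := by
  set U := max s₀ (β + (N + 1 : ℕ) + 1) with hU
  have h1 := contT_one_succ_eq_integral hκ hβ (N + 1) hs
    (show max s (β + (N + 1 : ℕ) + 1) ≤ U from max_le (hss₀.trans (le_max_left _ _)) (le_max_right _ _))
  have h2 := contT_one_succ_eq_integral hκ hβ (N + 1) (hs.trans hss₀) (le_refl U)
  rw [h1, h2]
  have hs1 : 1 < s := by linarith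
  rw [← intervalIntegral.integral_add_adjacent_intervals
    (intervalIntegrable_sieveKernel_mul (κ := κ) (continuous_contT hκ hβ 0 (N + 1)) hs1 hss₀)
    (intervalIntegrable_sieveKernel_mul (κ := κ) (continuous_contT hκ hβ 0 (N + 1)) (by linarith)
      (le_max_left s₀ _))]
  ring

/-! ### Elementary facts used in the induction step -/

/-- `t ↦ (1 − 1/t)^r` is non-increasing on `(1, ∞)` for `r ≤ 0`. [folklore] -/
theorem one_sub_inv_rpow_antitone {r : ℝ} (hr : r ≤ 0) {t t' : ℝ} (ht : 1 < t) (htt' : t ≤ t') :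
    (1 - 1 / t') ^ r ≤ (1 - 1 / t) ^ r := by
  have ht0 : 0 < t := by linarith
  have hb : 0 < 1 - 1 / t := by rw [sub_pos, div_lt_one ht0]; exact ht
  have hle : 1 - 1 / t ≤ 1 - 1 / t' := by
    have : 1 / t' ≤ 1 / t := one_div_le_one_div_of_le ht0 htt'
    linarith
  exact Real.rpow_le_rpow_of_nonpos hb hle hr

/-- `(1 − 1/t)^r ≤ (1 − 1/β)^r` for `t ≥ β > 1`, `r ≤ 0`, and positivity of the base. [folklore] -/
theorem one_sub_inv_rpow_le {r : ℝ} (hr : r ≤ 0) (hβ : 1 < β) {t : ℝ} (ht : β ≤ t) :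
    (1 - 1 / t) ^ r ≤ (1 - 1 / β) ^ r :=
  one_sub_inv_rpow_antitone hr hβ ht

/-- `0 < 1 − 1/t` for `t > 1`. [folklore] -/
theorem one_sub_inv_pos {t : ℝ} (ht : 1 < t) : 0 < 1 - 1 / t := by
  rw [sub_pos, div_lt_one (by linarith)]; exact ht

/-- `(1 − 1/t)^{−κ} ≤ (1 − 1/t)^{−κ−e}` for `t > 1`, `e ≥ 0`. [folklore] -/
theorem one_sub_inv_rpow_le_rpow {e t : ℝ} (he : 0 ≤ e) (ht : 1 < t) :
    (1 - 1 / t) ^ (-κ) ≤ (1 - 1 / t) ^ (-κ - e) := by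
  have hb := one_sub_inv_pos ht
  have h1t : 0 < 1 / t := by positivity
  have hb1 : 1 - 1 / t ≤ 1 := by linarith
  exact Real.rpow_le_rpow_of_exponent_ge hb hb1 (by linarith)

/-- `∑_{n ≤ N} T_n(D, P) ≤ V(P)⁻¹`: the whole boundary series is at most `∑_{t ∣ P} g(t) = ∏ (1 + g(p))
≤ ∏ (1 − g(p))⁻¹`. [folklore] -/
theorem discT_le_inv_vprod {g : ArithmeticFunction ℝ} (hg : g.IsMultiplicative) {P : ℕ} (hP : Squarefree P)
    (h01 : ∀ p ∈ P.primeFactors, 0 ≤ g p ∧ g p < 1) (par : ℕ) (β D : ℝ) (N : ℕ) :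
    discT par g β D P N ≤ (vprod g P)⁻¹ := by
  have h01' : ∀ p ∈ P.primeFactors, 0 ≤ g p ∧ g p ≤ 1 := fun p hp => ⟨(h01 p hp).1, (h01 p hp).2.le⟩
  have hgt : ∀ t ∈ P.divisors, 0 ≤ g t := by
    intro t ht
    have hd := Nat.dvd_of_mem_divisors ht
    rw [map_eq_prod_primeFactors hg (hP.squarefree_of_dvd hd)]
    exact Finset.prod_nonneg fun p hp => (h01 p (Nat.primeFactors_mono hd hP.ne_zero hp)).1
  calc discT par g β D P N ≤ ∑ n ∈ Finset.range (N + 1), ∑ t ∈ P.divisors with t.primeFactors.card = n, g t :=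
        Finset.sum_le_sum fun n _ => bdrySum_le_sum hg hP h01' par β D n
    _ ≤ ∑ t ∈ P.divisors, g t := by
        have hdisj : Set.PairwiseDisjoint (↑(Finset.range (N + 1)) : Set ℕ)
            (fun n => P.divisors.filter (fun t => t.primeFactors.card = n)) := by
          intro n _ m _ hnm
          simp only [Function.onFun, Finset.disjoint_left, Finset.mem_filter]
          rintro t ⟨-, htn⟩ ⟨-, htm⟩
          exact hnm (htn.symm.trans htm)
        rw [← Finset.sum_biUnion hdisj]
        refine Finset.sum_le_sum_of_subset_of_nonneg ?_ fun t ht _ => hgt t ht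
        intro t ht
        obtain ⟨n, -, htn⟩ := Finset.mem_biUnion.mp ht
        exact (Finset.mem_filter.mp htn).1
    _ = ∏ p ∈ P.primeFactors, (1 + g p) := (hg.prodPrimeFactors_one_add_of_squarefree hP).symm
    _ = ∏ p ∈ P.primeFactors, (1 + 1 * g p) := by simp only [one_mul]
    _ ≤ (vprod g P) ^ (-(1:ℝ)) := prod_one_add_mul_le h01 zero_le_one
    _ = (vprod g P)⁻¹ := Real.rpow_neg_one _

/-! ### Common facts about the level `y`, `s = log y/log z`, `s₀ = √(log y)`, `z₀ = e^{s₀}` -/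

/-- Basic inequalities at a level `y ≥ e⁴` with `√(log y) ≤ log z`, `z ≥ 2`:
`log y ≥ 4`, `s₀ = √(log y) ≥ 2`, `s₀² = log y`, `2 ≤ z₀ = e^{s₀} ≤ z`, `0 < s ≤ s₀`, `log z₀ = s₀`. [folklore] -/
theorem level_facts {y z : ℝ} (hy : Real.exp 4 ≤ y) (hz : 2 ≤ z) (hsz : Real.sqrt (Real.log y) ≤ Real.log z) :
    1 < y ∧ 4 ≤ Real.log y ∧ 2 ≤ Real.sqrt (Real.log y) ∧
      Real.sqrt (Real.log y) * Real.sqrt (Real.log y) = Real.log y ∧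
      2 ≤ Real.exp (Real.sqrt (Real.log y)) ∧ Real.exp (Real.sqrt (Real.log y)) ≤ z ∧
      0 < Real.log y / Real.log z ∧ Real.log y / Real.log z ≤ Real.sqrt (Real.log y) := by
  have hy1 : 1 < y := by linarith [Real.add_one_le_exp (4:ℝ)]
  have hlogy4 : 4 ≤ Real.log y := by rw [Real.le_log_iff_exp_le (by linarith)]; exact hy
  have hlogy : 0 < Real.log y := by linarith
  have hs2 : 2 ≤ Real.sqrt (Real.log y) := by
    rw [show (2:ℝ) = Real.sqrt 4 by rw [show (4:ℝ) = 2 ^ 2 by norm_num, Real.sqrt_sq (by norm_num)]]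
    exact Real.sqrt_le_sqrt hlogy4
  have hss : Real.sqrt (Real.log y) * Real.sqrt (Real.log y) = Real.log y := Real.mul_self_sqrt hlogy.le
  have hz1 : 1 < z := by linarith
  have hlogz : 0 < Real.log z := Real.log_pos hz1
  have hz₀2 : 2 ≤ Real.exp (Real.sqrt (Real.log y)) := by
    have : (2:ℝ) ≤ Real.exp 2 := by linarith [Real.add_one_le_exp (2:ℝ)]
    exact this.trans (Real.exp_le_exp.mpr hs2)
  have hz₀z : Real.exp (Real.sqrt (Real.log y)) ≤ z := by
    calc Real.exp (Real.sqrt (Real.log y)) ≤ Real.exp (Real.log z) := Real.exp_le_exp.mpr hsz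
      _ = z := Real.exp_log (by linarith)
  refine ⟨hy1, hlogy4, hs2, hss, hz₀2, hz₀z, div_pos hlogy hlogz, ?_⟩
  rw [div_le_iff₀ hlogz]
  calc Real.log y = Real.sqrt (Real.log y) * Real.sqrt (Real.log y) := hss.symm
    _ ≤ Real.sqrt (Real.log y) * Real.log z := mul_le_mul_of_nonneg_left hsz (by linarith)

/-- `V(P(z₀)) ≤ (s₀/s)^κ (1 + L/s₀) V(P(z))` for `z₀ = e^{s₀} ≤ z` (`Ω(κ, L)`): the form of
`HasIwaniecDimension.vprod_le` at the truncation level. [folklore] -/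
theorem vprod_exp_sqrt_le {g : ArithmeticFunction ℝ} {L : ℝ} (hdim : HasIwaniecDimension g κ L)
    {y z : ℝ} (hy : Real.exp 4 ≤ y) (hz : 2 ≤ z) (hsz : Real.sqrt (Real.log y) ≤ Real.log z) :
    vprod g (primesProdBelow (Real.exp (Real.sqrt (Real.log y)))) ≤
      (Real.sqrt (Real.log y) / (Real.log y / Real.log z)) ^ κ * (1 + L / Real.sqrt (Real.log y)) *
        vprod g (primesProdBelow z) := by
  obtain ⟨hy1, -, hs2, hss, hz₀2, hz₀z, hs0, -⟩ := level_facts hy hz hsz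
  have h := hdim.vprod_le hz₀2 hz₀z
  rw [Real.log_exp] at h
  have hlogz : 0 < Real.log z := Real.log_pos (by linarith)
  have hs₀0 : 0 < Real.sqrt (Real.log y) := by linarith
  have hratio : Real.log z / Real.sqrt (Real.log y) = Real.sqrt (Real.log y) / (Real.log y / Real.log z) := by
    rw [div_div_eq_mul_div, div_eq_div_iff hs₀0.ne' (by nlinarith)]
    linear_combination (-(Real.log z)) * hss
  rwa [hratio] at h

/-- `(s₀/s)^κ · s₀^{−κ} = s^{−κ}` for `s, s₀ > 0`. [folklore] -/
theorem div_rpow_mul_rpow_neg {s s₀ : ℝ} (hs : 0 < s) (hs₀ : 0 < s₀) (κ : ℝ) :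
    (s₀ / s) ^ κ * s₀ ^ (-κ) = s ^ (-κ) := by
  rw [Real.div_rpow hs₀.le hs.le, Real.rpow_neg hs₀.le, Real.rpow_neg hs.le]
  have : s₀ ^ κ ≠ 0 := (Real.rpow_pos_of_pos hs₀ κ).ne'
  field_simp

/-! ### The lower-parity induction step -/

/-- **Induction step for `T⁻`** (Iwaniec, §8, proof of Lemma 20, lower sign): if the upper partial
sums `T⁺_{N+1}` satisfy the inductive bound with amplitude `a` at every level, then `T⁻_{N+2}` satisfies
it with amplitude `2 + (1 + ε) a`. The level `y` is decomposed at `z₀ = e^{√(log y)}`: the part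
`T⁻_{N+2}(y, P(z₀))` is bounded crudely (`hcrude`, Rankin), the primes `z₀ ≤ p < z` are peeled off
((4.4)), the inductive bound is inserted at `(y/p, p)`, and Lemma 21 (partial summation under
`Ω(κ, L)`, `sum_peeled_le`) turns the sum into `∫_s^{s₀} k(t) T⁺_{N+1}(t − 1) dt = T⁻_{N+2}(s) − T⁻_{N+2}(s₀)`
((7.3)) plus error terms controlled by the majorant package (`hH1`, `hH3`, `hH4`, `hH6`).
[cite: IwaniecActaArith1980, Lemma 20 (proof, (8.5)–(8.9))] -/
theorem step_zero {L e ε₁ R c₀ : ℝ} {Hp Hm : ℝ → ℝ} {g : ArithmeticFunction ℝ}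
    (hκ : 0 < κ) (hβ : 1 < β) (hL : 0 ≤ L) (he0 : 0 ≤ e) (he : e < 1 / 2) (hR : 0 ≤ R) (hc₀ : 0 ≤ c₀)
    (hHpos : ∀ s, 0 < Hp s ∧ 0 < Hm s) (hHp_anti : Antitone Hp) (hHp_cont : Continuous Hp)
    (hH1 : ∀ s U : ℝ, β ≤ s → s ≤ U →
      ∫ t in s..U, sieveKernel κ t * (1 - 1 / t) ^ (-e) * Hp (t - 1) ≤ (1 + ε₁) * Hm s)
    (hH3 : ∀ s, β ≤ s → Hp (s - 1) ≤ R * Hm s)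
    (hH4 : ∀ (N : ℕ) (u : ℝ), β - 1 ≤ u → contT 1 κ β N u ≤ c₀ * Hp u)
    (hH6 : ∀ s, Real.exp (-s) ≤ Hm s)
    (hg : g.IsMultiplicative) (hdim : HasIwaniecDimension g κ L)
    {Ccr yc : ℝ} (hCcr : 0 ≤ Ccr)
    (hcrude : ∀ y : ℝ, yc ≤ y → ∀ (par N : ℕ),
      discT par g β y (primesProdBelow (Real.exp (Real.sqrt (Real.log y)))) N ≤
        Ccr * vprod g (primesProdBelow (Real.exp (Real.sqrt (Real.log y)))) *
          Real.sqrt (Real.log y) ^ (-κ) * Real.exp (-Real.sqrt (Real.log y)) * Real.log y ^ (-e))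
    {C ε y₀ : ℝ} (hC1 : 1 ≤ C) (hC2 : Ccr * (1 + L) ≤ C) (hy₀c : yc ≤ y₀) (hy₀4 : Real.exp 4 ≤ y₀)
    (hy₀b : (κ + 1) * L * (1 - 1 / β) ^ (-κ - e) * R * c₀ * Real.log y₀ ^ (e - 1 / 2) ≤ 1)
    (hε : ε₁ + (κ + 1) * L * (1 - 1 / β) ^ (-κ - e) * R * Real.log y₀ ^ (-(1 / 2 : ℝ)) ≤ ε)
    {a : ℝ} (ha : 0 ≤ a) {N : ℕ}
    (hP1 : ∀ y z : ℝ, 2 ≤ z → z ^ (β - 1) < y → Real.sqrt (Real.log y) ≤ Real.log z →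
      discT 1 g β y (primesProdBelow z) (N + 1) ≤
        vprod g (primesProdBelow z) * (Real.log y / Real.log z) ^ (-κ) *
          (contT 1 κ β (N + 1) (Real.log y / Real.log z) +
            a * C * Hp (Real.log y / Real.log z) * Real.log y ^ (-e))) :
    ∀ y z : ℝ, y₀ ≤ y → 2 ≤ z → z ^ β < y → Real.sqrt (Real.log y) ≤ Real.log z →
      discT 0 g β y (primesProdBelow z) (N + 2) ≤
        vprod g (primesProdBelow z) * (Real.log y / Real.log z) ^ (-κ) *
          (contT 0 κ β (N + 2) (Real.log y / Real.log z) +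
            (2 + (1 + ε) * a) * C * Hm (Real.log y / Real.log z) * Real.log y ^ (-e)) := by
  intro y z hy hz hzy hsz
  have hC0 : (0:ℝ) ≤ C := le_trans zero_le_one hC1
  have hy4 : Real.exp 4 ≤ y := hy₀4.trans hy
  obtain ⟨hy1, hly4, hs₀2, hss, hz₀2, hz₀z, hs0, hss₀⟩ := level_facts hy4 hz hsz
  set ly := Real.log y with hly
  set s₀ := Real.sqrt ly with hs₀def
  set z₀ := Real.exp s₀ with hz₀def
  set s := ly / Real.log z with hsdef
  have hlypos : 0 < ly := by linarith
  have hs₀0 : 0 < s₀ := by linarith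
  have hz1 : 1 < z := by linarith
  have hlogz : 0 < Real.log z := Real.log_pos hz1
  have hβ0 : 0 < β := by linarith
  have hy0 : 0 < y := by linarith
  -- `β < s` from `z^β < y`, and `z < y`
  have hβs : β < s := by
    rw [hsdef, lt_div_iff₀ hlogz, ← Real.log_rpow (by linarith)]
    exact Real.log_lt_log (Real.rpow_pos_of_pos (by linarith) β) hzy
  have hs1 : 1 < s := by linarith
  have hzy' : z < y := by
    have : z ≤ z ^ β := by
      calc z = z ^ (1:ℝ) := (Real.rpow_one z).symm
        _ ≤ z ^ β := Real.rpow_le_rpow_of_exponent_le hz1.le hβ.le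
    linarith
  set V := vprod g (primesProdBelow z) with hVdef
  have hV : 0 < V := hdim.vprod_pos z
  have hbβ0 : 0 < 1 - 1 / β := one_sub_inv_pos hβ
  set bβ := (1 - 1 / β) ^ (-κ - e) with hbβ
  have hbβpos : 0 < bβ := Real.rpow_pos_of_pos hbβ0 _
  set T := ly ^ (-e) with hT
  have hT0 : 0 < T := Real.rpow_pos_of_pos hlypos _
  have hHm := (hHpos s).2
  -- (1) decomposition at `z₀`
  have hident := discT_zero_succ_succ_sub hg β y hz₀z N
  -- (2) the truncated part
  have htrunc : discT 0 g β y (primesProdBelow z₀) (N + 2) ≤ Ccr * (1 + L) * (V * s ^ (-κ) * (Hm s * T)) := by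
    have hcr := hcrude y (hy₀c.trans hy) 0 (N + 2)
    have hV₀ := vprod_exp_sqrt_le hdim hy4 hz hsz
    have hV₀pos : 0 < vprod g (primesProdBelow z₀) := hdim.vprod_pos z₀
    have h1 : Ccr * vprod g (primesProdBelow z₀) * s₀ ^ (-κ) * Real.exp (-s₀) * T ≤
        Ccr * ((s₀ / s) ^ κ * (1 + L / s₀) * V) * s₀ ^ (-κ) * Real.exp (-s₀) * T :=
      mul_le_mul_of_nonneg_right (mul_le_mul_of_nonneg_right (mul_le_mul_of_nonneg_right
        (mul_le_mul_of_nonneg_left hV₀ hCcr) (Real.rpow_nonneg hs₀0.le _)) (Real.exp_pos _).le) hT0.le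
    have h2 : (s₀ / s) ^ κ * (1 + L / s₀) * V * s₀ ^ (-κ) = (1 + L / s₀) * (V * s ^ (-κ)) := by
      rw [← div_rpow_mul_rpow_neg hs0 hs₀0 κ]; ring
    have h3 : 1 + L / s₀ ≤ 1 + L := by
      have : L / s₀ ≤ L / 1 := div_le_div_of_nonneg_left hL one_pos (by linarith)
      rw [div_one] at this; linarith
    have h4 : Real.exp (-s₀) ≤ Hm s := (Real.exp_le_exp.mpr (neg_le_neg hss₀)).trans (hH6 s)
    calc discT 0 g β y (primesProdBelow z₀) (N + 2)
        ≤ Ccr * vprod g (primesProdBelow z₀) * s₀ ^ (-κ) * Real.exp (-s₀) * T := hcr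
      _ ≤ Ccr * ((s₀ / s) ^ κ * (1 + L / s₀) * V) * s₀ ^ (-κ) * Real.exp (-s₀) * T := h1
      _ = Ccr * (1 + L / s₀) * (V * s ^ (-κ)) * Real.exp (-s₀) * T := by
          rw [show Ccr * ((s₀ / s) ^ κ * (1 + L / s₀) * V) * s₀ ^ (-κ) =
            Ccr * ((s₀ / s) ^ κ * (1 + L / s₀) * V * s₀ ^ (-κ)) by ring, h2]; ring
      _ ≤ Ccr * (1 + L) * (V * s ^ (-κ)) * Hm s * T := by
          have hVs : 0 ≤ V * s ^ (-κ) := mul_nonneg hV.le (Real.rpow_nonneg hs0.le _)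
          refine mul_le_mul_of_nonneg_right (mul_le_mul (mul_le_mul_of_nonneg_right
            (mul_le_mul_of_nonneg_left h3 hCcr) hVs) h4 (Real.exp_pos _).le ?_) hT0.le
          exact mul_nonneg (mul_nonneg hCcr (by linarith)) hVs
      _ = Ccr * (1 + L) * (V * s ^ (-κ) * (Hm s * T)) := by ring
  -- (3) the peeled primes: the weight function `Φ`
  set Φ : ℝ → ℝ := fun t => (1 - 1 / t) ^ (-κ) * contT 1 κ β (N + 1) (t - 1) +
    a * C * T * ((1 - 1 / t) ^ (-κ - e) * Hp (t - 1)) with hΦdef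
  have haCT : 0 ≤ a * C * T := mul_nonneg (mul_nonneg ha hC0) hT0.le
  have hΦ0 : ∀ t, 1 < t → 0 ≤ Φ t := by
    intro t ht
    have h1 : 0 ≤ (1 - 1 / t) ^ (-κ) := Real.rpow_nonneg (one_sub_inv_pos ht).le _
    have h2 : 0 ≤ (1 - 1 / t) ^ (-κ - e) := Real.rpow_nonneg (one_sub_inv_pos ht).le _
    have h3 : 0 ≤ contT 1 κ β (N + 1) (t - 1) := contT_nonneg hκ.le hβ.le 1 (N + 1) (by linarith)
    have h4 := (hHpos (t - 1)).1.le
    simp only [hΦdef]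
    exact add_nonneg (mul_nonneg h1 h3) (mul_nonneg haCT (mul_nonneg h2 h4))
  have hΦm : AntitoneOn Φ (Icc s s₀) := by
    intro t ht t' ht' htt'
    have ht1 : 1 < t := by linarith [ht.1]
    have ht'1 : 1 < t' := by linarith [ht'.1]
    simp only [hΦdef]
    refine add_le_add ?_ (mul_le_mul_of_nonneg_left ?_ haCT)
    · refine mul_le_mul (one_sub_inv_rpow_antitone (by linarith) ht1 htt')
        (contT_antitoneOn hκ.le hβ 1 (N + 1) (show (0:ℝ) ≤ t - 1 by linarith)
          (show (0:ℝ) ≤ t' - 1 by linarith) (by linarith))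
        (contT_nonneg hκ.le hβ.le 1 (N + 1) (by linarith)) (Real.rpow_nonneg (one_sub_inv_pos ht1).le _)
    · refine mul_le_mul (one_sub_inv_rpow_antitone (by linarith) ht1 htt') (hHp_anti (by linarith))
        (hHpos _).1.le (Real.rpow_nonneg (one_sub_inv_pos ht1).le _)
  have hΦc : ContinuousOn Φ (Icc s s₀) := by
    have hbase : ∀ r : ℝ, ContinuousOn (fun t : ℝ => (1 - 1 / t) ^ r) (Icc s s₀) := by
      intro r t ht
      have ht1 : 1 < t := by linarith [ht.1]
      exact ((continuousAt_const.sub (continuousAt_const.div continuousAt_id (ne_of_gt (show (0:ℝ) < id t by simp only [id]; linarith)))).rpow_const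
        (Or.inl (one_sub_inv_pos ht1).ne')).continuousWithinAt
    simp only [hΦdef]
    exact ((hbase (-κ)).mul ((continuous_contT hκ.le hβ 1 (N + 1)).comp
      (continuous_id.sub continuous_const)).continuousOn).add
      (continuousOn_const.mul ((hbase (-κ - e)).mul
        (hHp_cont.comp (continuous_id.sub continuous_const)).continuousOn))
  -- (3a) pointwise insertion of the inductive bound
  have hpt : ∀ p ∈ (Nat.primesBelow ⌈z⌉₊).filter (fun p : ℕ => z₀ ≤ (p : ℝ)),
      g p * discT 1 g β (y / p) (primesProdBelow p) (N + 1) ≤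
        s ^ (-κ) * (g p * vprod g (primesProdBelow p) * ((Real.log p / Real.log z) ^ κ * Φ (ly / Real.log p))) := by
    intro p hp
    rw [Finset.mem_filter, Nat.mem_primesBelow] at hp
    obtain ⟨⟨hpz, hpp⟩, hz₀p⟩ := hp
    have hpzR : (p : ℝ) < z := Nat.lt_ceil.mp hpz
    have hp2 : (2 : ℝ) ≤ p := hz₀2.trans hz₀p
    have hp1 : (1 : ℝ) < p := by linarith
    have hp0 : (0 : ℝ) < p := by linarith
    have hpy : (p : ℝ) < y := hpzR.trans hzy'
    have hlogp : 0 < Real.log p := Real.log_pos hp1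
    have hlogpz : Real.log p < Real.log z := Real.log_lt_log hp0 hpzR
    have hlogps₀ : s₀ ≤ Real.log p := by
      have := Real.log_le_log (by linarith : (0:ℝ) < z₀) hz₀p
      rwa [hz₀def, Real.log_exp] at this
    set tp := ly / Real.log p with htp
    have htp_gt : s < tp := div_lt_div_of_pos_left hlypos hlogp hlogpz
    have htp_le : tp ≤ s₀ := by
      rw [htp, div_le_iff₀ hlogp]
      calc ly = s₀ * s₀ := hss.symm
        _ ≤ s₀ * Real.log p := mul_le_mul_of_nonneg_left hlogps₀ hs₀0.le
    have htp1 : 1 < tp := by linarith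
    have htp0 : 0 < tp := by linarith
    -- the inductive bound at `(y/p, p)`
    have hcond2 : (p : ℝ) ^ (β - 1) < y / p := by
      rw [Real.rpow_sub_one hp0.ne', div_lt_div_iff_of_pos_right hp0]
      calc (p : ℝ) ^ β < z ^ β := Real.rpow_lt_rpow hp0.le hpzR hβ0
        _ < y := hzy
    have hlogyp : Real.log (y / p) = ly - Real.log p := Real.log_div hy0.ne' hp0.ne'
    have hlyp : ly - Real.log p = ly * (1 - 1 / tp) := by
      rw [htp]; field_simp
    have hcond3 : Real.sqrt (Real.log (y / p)) ≤ Real.log p := by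
      rw [hlogyp, Real.sqrt_le_left hlogp.le]
      calc ly - Real.log p ≤ ly := by linarith
        _ = s₀ * s₀ := hss.symm
        _ ≤ Real.log p * Real.log p := mul_le_mul hlogps₀ hlogps₀ hs₀0.le hlogp.le
        _ = Real.log p ^ 2 := (sq _).symm
    have hind := hP1 (y / p) p hp2 hcond2 hcond3
    rw [hlogyp] at hind
    have hs' : (ly - Real.log p) / Real.log p = tp - 1 := by rw [htp]; field_simp
    rw [hs'] at hind
    -- normalisations
    have hnorm := rpow_neg_log_div_log_sub_one hy1 hz1 hp1 hpy κ
    rw [← htp, ← hsdef] at hnorm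
    have hbase0 : 0 ≤ 1 - 1 / tp := (one_sub_inv_pos htp1).le
    have hloge : (ly - Real.log p) ^ (-e) = T * (1 - 1 / tp) ^ (-e) := by
      rw [hlyp, Real.mul_rpow hlypos.le hbase0]
    rw [hnorm, hloge] at hind
    have hgp : 0 ≤ g p := (hdim.1 p hpp).1
    have hkey : vprod g (primesProdBelow p) * ((Real.log p / Real.log z) ^ κ * s ^ (-κ) * (1 - 1 / tp) ^ (-κ)) *
        (contT 1 κ β (N + 1) (tp - 1) + a * C * Hp (tp - 1) * (T * (1 - 1 / tp) ^ (-e))) =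
        s ^ (-κ) * (vprod g (primesProdBelow p) * ((Real.log p / Real.log z) ^ κ * Φ tp)) := by
      simp only [hΦdef]
      rw [show (-κ - e : ℝ) = -κ + -e by ring, Real.rpow_add (one_sub_inv_pos htp1)]
      ring
    calc g p * discT 1 g β (y / p) (primesProdBelow p) (N + 1)
        ≤ g p * (vprod g (primesProdBelow p) * ((Real.log p / Real.log z) ^ κ * s ^ (-κ) * (1 - 1 / tp) ^ (-κ)) *
            (contT 1 κ β (N + 1) (tp - 1) + a * C * Hp (tp - 1) * (T * (1 - 1 / tp) ^ (-e)))) :=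
          mul_le_mul_of_nonneg_left hind hgp
      _ = s ^ (-κ) * (g p * vprod g (primesProdBelow p) * ((Real.log p / Real.log z) ^ κ * Φ tp)) := by
          rw [hkey]; ring
  -- (3b) partial summation
  have hsum0 : ∑ p ∈ (Nat.primesBelow ⌈z⌉₊).filter (fun p : ℕ => z₀ ≤ (p : ℝ)),
      g p * discT 1 g β (y / p) (primesProdBelow p) (N + 1) ≤
      s ^ (-κ) * (V * (κ * (∫ t in s..s₀, Φ t / t) + Φ s * ((κ + 1) * L / s₀))) := by
    have hlogz₀' : Real.log z₀ = s₀ := by rw [hz₀def, Real.log_exp]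
    have hlys₀ : ly / s₀ = s₀ := by rw [div_eq_iff hs₀0.ne']; exact hss.symm
    have h21 := sum_peeled_le hdim hκ.le hy1 hz₀2 hz₀z (Φ := Φ)
      (fun t ht => hΦ0 t (by rw [← hsdef] at ht; linarith [ht.1]))
      (by rw [← hsdef, hlogz₀', hlys₀]; exact hΦm)
      (by rw [← hsdef, hlogz₀', hlys₀]; exact hΦc)
    rw [← hsdef, hlogz₀', hlys₀] at h21
    calc ∑ p ∈ (Nat.primesBelow ⌈z⌉₊).filter (fun p : ℕ => z₀ ≤ (p : ℝ)),
          g p * discT 1 g β (y / p) (primesProdBelow p) (N + 1)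
        ≤ ∑ p ∈ (Nat.primesBelow ⌈z⌉₊).filter (fun p : ℕ => z₀ ≤ (p : ℝ)),
            s ^ (-κ) * (g p * vprod g (primesProdBelow p) * ((Real.log p / Real.log z) ^ κ * Φ (ly / Real.log p))) :=
          Finset.sum_le_sum hpt
      _ = s ^ (-κ) * ∑ p ∈ (Nat.primesBelow ⌈z⌉₊).filter (fun p : ℕ => z₀ ≤ (p : ℝ)),
            g p * vprod g (primesProdBelow p) * ((Real.log p / Real.log z) ^ κ * Φ (ly / Real.log p)) := by
          rw [Finset.mul_sum]
      _ ≤ s ^ (-κ) * (V * (κ * (∫ t in s..s₀, Φ t / t) + Φ s * ((κ + 1) * L / s₀))) :=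
          mul_le_mul_of_nonneg_left h21 (Real.rpow_nonneg hs0.le _)
  -- (3c) the integral: main part and `H`-part
  have hint_eval : κ * (∫ t in s..s₀, Φ t / t) =
      (∫ t in s..s₀, sieveKernel κ t * contT 1 κ β (N + 1) (t - 1)) +
        a * C * T * ∫ t in s..s₀, sieveKernel κ t * (1 - 1 / t) ^ (-e) * Hp (t - 1) := by
    have hi1 : IntervalIntegrable (fun t => sieveKernel κ t * contT 1 κ β (N + 1) (t - 1)) volume s s₀ :=
      intervalIntegrable_sieveKernel_mul (continuous_contT hκ.le hβ 1 (N + 1)) hs1 hss₀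
    have hi2 : IntervalIntegrable (fun t => sieveKernel κ t * (1 - 1 / t) ^ (-e) * Hp (t - 1)) volume s s₀ := by
      refine ContinuousOn.intervalIntegrable ?_
      rw [uIcc_of_le hss₀]
      exact ((continuousOn_sieveKernel_mul_rpow κ e).mono fun t ht => show (1:ℝ) < t by linarith [ht.1]).mul
        (hHp_cont.comp (continuous_id.sub continuous_const)).continuousOn
    rw [← intervalIntegral.integral_const_mul, ← intervalIntegral.integral_const_mul,
      ← intervalIntegral.integral_add hi1 (hi2.const_mul _)]
    refine intervalIntegral.integral_congr fun t ht => ?_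
    rw [uIcc_of_le hss₀] at ht
    have ht1 : 1 < t := by linarith [ht.1]
    have ht0 : (0:ℝ) < t := by linarith
    simp only [hΦdef]
    rw [sieveKernel_mul_rpow_eq ht1, sieveKernel_eq_of_one_lt ht1]
    field_simp
  have hmain : ∫ t in s..s₀, sieveKernel κ t * contT 1 κ β (N + 1) (t - 1) ≤ contT 0 κ β (N + 2) s := by
    rw [← contT_zero_sub_eq_integral hκ.le hβ N hβs.le hss₀]
    linarith [contT_nonneg hκ.le hβ.le 0 (N + 2) (show (0:ℝ) ≤ s₀ by linarith)]
  have hHpart : ∫ t in s..s₀, sieveKernel κ t * (1 - 1 / t) ^ (-e) * Hp (t - 1) ≤ (1 + ε₁) * Hm s :=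
    hH1 s s₀ hβs.le hss₀
  -- (3d) the boundary term
  have hbdry : Φ s ≤ bβ * (c₀ + a * C * T) * (R * Hm s) := by
    have h1 : (1 - 1 / s) ^ (-κ) ≤ (1 - 1 / s) ^ (-κ - e) := one_sub_inv_rpow_le_rpow he0 hs1
    have h2 : (1 - 1 / s) ^ (-κ - e) ≤ bβ := one_sub_inv_rpow_le (by linarith) hβ hβs.le
    have h3 : contT 1 κ β (N + 1) (s - 1) ≤ c₀ * Hp (s - 1) := hH4 (N + 1) (s - 1) (by linarith)
    have h4 : Hp (s - 1) ≤ R * Hm s := hH3 s hβs.le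
    have hT1 : 0 ≤ contT 1 κ β (N + 1) (s - 1) := contT_nonneg hκ.le hβ.le 1 (N + 1) (by linarith)
    have hHp0 := (hHpos (s - 1)).1.le
    have hr0 : 0 ≤ (1 - 1 / s) ^ (-κ) := Real.rpow_nonneg (one_sub_inv_pos hs1).le _
    simp only [hΦdef]
    calc (1 - 1 / s) ^ (-κ) * contT 1 κ β (N + 1) (s - 1) + a * C * T * ((1 - 1 / s) ^ (-κ - e) * Hp (s - 1))
        ≤ bβ * (c₀ * Hp (s - 1)) + a * C * T * (bβ * Hp (s - 1)) :=
          add_le_add (mul_le_mul (h1.trans h2) h3 hT1 hbβpos.le)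
            (mul_le_mul_of_nonneg_left (mul_le_mul_of_nonneg_right h2 hHp0) haCT)
      _ = bβ * (c₀ + a * C * T) * Hp (s - 1) := by ring
      _ ≤ bβ * (c₀ + a * C * T) * (R * Hm s) :=
          mul_le_mul_of_nonneg_left h4 (mul_nonneg hbβpos.le (add_nonneg hc₀ haCT))
  -- (4) assembly of the error terms
  have hly₀le : Real.log y₀ ≤ ly := Real.log_le_log (by linarith [Real.add_one_le_exp (4:ℝ)]) hy
  have hly₀pos : 0 < Real.log y₀ := by
    have : (4:ℝ) ≤ Real.log y₀ := by
      rw [Real.le_log_iff_exp_le (by linarith [Real.add_one_le_exp (4:ℝ)])]; exact hy₀4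
    linarith
  have hs₀inv : 1 / s₀ = ly ^ (-(1 / 2 : ℝ)) := by
    rw [hs₀def, Real.sqrt_eq_rpow, Real.rpow_neg hlypos.le, one_div]
  have hs₀T : (κ + 1) * L * bβ * R * c₀ / s₀ ≤ C * T := by
    have hmono : ly ^ (e - 1 / 2) ≤ Real.log y₀ ^ (e - 1 / 2) :=
      Real.rpow_le_rpow_of_nonpos hly₀pos hly₀le (by linarith)
    have h1 : (κ + 1) * L * bβ * R * c₀ * ly ^ (e - 1 / 2) ≤ 1 :=
      le_trans (mul_le_mul_of_nonneg_left hmono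
        (mul_nonneg (mul_nonneg (mul_nonneg (mul_nonneg (by linarith) hL) hbβpos.le) hR) hc₀)) hy₀b
    have hsplit : 1 / s₀ = ly ^ (e - 1 / 2) * T := by
      rw [hs₀inv, hT, ← Real.rpow_add hlypos]; ring_nf
    have hdiv : (κ + 1) * L * bβ * R * c₀ / s₀ = ((κ + 1) * L * bβ * R * c₀) * (1 / s₀) := by ring
    calc (κ + 1) * L * bβ * R * c₀ / s₀ = ((κ + 1) * L * bβ * R * c₀) * (ly ^ (e - 1 / 2) * T) := by
          rw [hdiv, hsplit]
      _ = ((κ + 1) * L * bβ * R * c₀ * ly ^ (e - 1 / 2)) * T := by ring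
      _ ≤ 1 * T := mul_le_mul_of_nonneg_right h1 hT0.le
      _ ≤ C * T := mul_le_mul_of_nonneg_right hC1 hT0.le
  have hεT : ε₁ + (κ + 1) * L * bβ * R / s₀ ≤ ε := by
    have hmono : ly ^ (-(1 / 2 : ℝ)) ≤ Real.log y₀ ^ (-(1 / 2 : ℝ)) :=
      Real.rpow_le_rpow_of_nonpos hly₀pos hly₀le (by norm_num)
    have : (κ + 1) * L * bβ * R / s₀ ≤ (κ + 1) * L * bβ * R * Real.log y₀ ^ (-(1 / 2 : ℝ)) := by
      rw [div_eq_mul_one_div, hs₀inv]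
      exact mul_le_mul_of_nonneg_left hmono (mul_nonneg (mul_nonneg (mul_nonneg (by linarith) hL) hbβpos.le) hR)
    linarith
  -- final combination
  have hsum := hsum0
  rw [hint_eval] at hsum
  have hE : V * (((∫ t in s..s₀, sieveKernel κ t * contT 1 κ β (N + 1) (t - 1)) +
        a * C * T * ∫ t in s..s₀, sieveKernel κ t * (1 - 1 / t) ^ (-e) * Hp (t - 1)) +
        Φ s * ((κ + 1) * L / s₀)) ≤
      V * (contT 0 κ β (N + 2) s + (a * C * T * (1 + ε₁) + (κ + 1) * L * bβ * R * (c₀ + a * C * T) / s₀) * Hm s) := by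
    refine mul_le_mul_of_nonneg_left ?_ hV.le
    have h1 : a * C * T * (∫ t in s..s₀, sieveKernel κ t * (1 - 1 / t) ^ (-e) * Hp (t - 1)) ≤
        a * C * T * ((1 + ε₁) * Hm s) := mul_le_mul_of_nonneg_left hHpart haCT
    have h2 : Φ s * ((κ + 1) * L / s₀) ≤ bβ * (c₀ + a * C * T) * (R * Hm s) * ((κ + 1) * L / s₀) :=
      mul_le_mul_of_nonneg_right hbdry (div_nonneg (mul_nonneg (by linarith) hL) hs₀0.le)
    have h3 : bβ * (c₀ + a * C * T) * (R * Hm s) * ((κ + 1) * L / s₀) =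
        (κ + 1) * L * bβ * R * (c₀ + a * C * T) / s₀ * Hm s := by ring
    linarith [h1, h2, h3, hmain]
  have hcoef : Ccr * (1 + L) * T + (a * C * T * (1 + ε₁) + (κ + 1) * L * bβ * R * (c₀ + a * C * T) / s₀) ≤
      (2 + (1 + ε) * a) * C * T := by
    have h1 : Ccr * (1 + L) * T ≤ C * T := mul_le_mul_of_nonneg_right hC2 hT0.le
    have h2 : (κ + 1) * L * bβ * R * (c₀ + a * C * T) / s₀ =
        (κ + 1) * L * bβ * R * c₀ / s₀ + ((κ + 1) * L * bβ * R / s₀) * (a * C * T) := by ring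
    have h3 : ((κ + 1) * L * bβ * R / s₀) * (a * C * T) ≤ (ε - ε₁) * (a * C * T) :=
      mul_le_mul_of_nonneg_right (by linarith) haCT
    rw [h2]
    linarith [h1, hs₀T, h3]
  calc discT 0 g β y (primesProdBelow z) (N + 2)
      = discT 0 g β y (primesProdBelow z₀) (N + 2) +
          ∑ p ∈ (Nat.primesBelow ⌈z⌉₊).filter (fun p : ℕ => z₀ ≤ (p : ℝ)),
            g p * discT 1 g β (y / p) (primesProdBelow p) (N + 1) := by linarith [hident]
    _ ≤ Ccr * (1 + L) * (V * s ^ (-κ) * (Hm s * T)) +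
          s ^ (-κ) * (V * (contT 0 κ β (N + 2) s +
            (a * C * T * (1 + ε₁) + (κ + 1) * L * bβ * R * (c₀ + a * C * T) / s₀) * Hm s)) := by
        have := mul_le_mul_of_nonneg_left hE (Real.rpow_nonneg hs0.le (-κ))
        linarith [htrunc, hsum]
    _ = V * s ^ (-κ) * (contT 0 κ β (N + 2) s +
          (Ccr * (1 + L) * T + (a * C * T * (1 + ε₁) + (κ + 1) * L * bβ * R * (c₀ + a * C * T) / s₀)) * Hm s) := by
        ring
    _ ≤ V * s ^ (-κ) * (contT 0 κ β (N + 2) s + (2 + (1 + ε) * a) * C * T * Hm s) :=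
        mul_le_mul_of_nonneg_left (by linarith [mul_le_mul_of_nonneg_right hcoef hHm.le])
          (mul_nonneg hV.le (Real.rpow_nonneg hs0.le _))
    _ = V * s ^ (-κ) * (contT 0 κ β (N + 2) s + (2 + (1 + ε) * a) * C * Hm s * T) := by ring

/-! ### The upper-parity induction step, range `s ≥ β + 1` -/

set_option maxHeartbeats 400000 in
/-- **Induction step for `T⁺` in the range `s ≥ β + 1`** (Iwaniec, §8, proof of Lemma 20, upper sign): if
the lower partial sums `T⁻_{N+1}` satisfy the inductive bound with amplitude `a` at every level, then
`T⁺_{N+2}` satisfies it with amplitude `2 + (1 + ε) a` for `z^{β+1} ≤ y`. The level `y` is decomposed at `z₀ = e^{√(log y)}`: the part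
`T⁺_{N+2}(y, P(z₀))` is bounded crudely, the first upper sum `T⁺_1(y, P(z))` vanishes for `z^{β+1} ≤ y`,
the primes `z₀ ≤ p < z` are peeled off ((4.5)), the inductive bound is inserted at `(y/p, p)`, and
Lemma 21 turns the sum into `∫_s^{s₀} k(t) T⁻_{N+1}(t − 1) dt = T⁺_{N+2}(s) − T⁺_{N+2}(s₀)` ((7.3)) plus error
terms controlled by the majorant package (`hH2`, `hH3`, `hH4`, `hH6`).
[cite: IwaniecActaArith1980, Lemma 20 (proof, (8.5)–(8.9))] -/
theorem step_one_high {L e ε₁ R c₀ : ℝ} {Hp Hm : ℝ → ℝ} {g : ArithmeticFunction ℝ}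
    (hκ : 0 < κ) (hβ : 1 < β) (hL : 0 ≤ L) (he0 : 0 ≤ e) (he : e < 1 / 2) (hR : 0 ≤ R) (hc₀ : 0 ≤ c₀)
    (hHpos : ∀ s, 0 < Hp s ∧ 0 < Hm s) (hHm_anti : Antitone Hm) (hHm_cont : Continuous Hm)
    (hH2 : ∀ s U : ℝ, β + 1 ≤ s → s ≤ U →
      ∫ t in s..U, sieveKernel κ t * (1 - 1 / t) ^ (-e) * Hm (t - 1) ≤ (1 + ε₁) * Hp s)
    (hH3 : ∀ s, β + 1 ≤ s → Hm (s - 1) ≤ R * Hp s)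
    (hH4 : ∀ (N : ℕ) (u : ℝ), β ≤ u → contT 0 κ β N u ≤ c₀ * Hm u)
    (hH6 : ∀ s, Real.exp (-s) ≤ Hp s)
    (hg : g.IsMultiplicative) (hdim : HasIwaniecDimension g κ L)
    {Ccr yc : ℝ} (hCcr : 0 ≤ Ccr)
    (hcrude : ∀ y : ℝ, yc ≤ y → ∀ (par N : ℕ),
      discT par g β y (primesProdBelow (Real.exp (Real.sqrt (Real.log y)))) N ≤
        Ccr * vprod g (primesProdBelow (Real.exp (Real.sqrt (Real.log y)))) *
          Real.sqrt (Real.log y) ^ (-κ) * Real.exp (-Real.sqrt (Real.log y)) * Real.log y ^ (-e))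
    {C ε y₀ : ℝ} (hC1 : 1 ≤ C) (hC2 : Ccr * (1 + L) ≤ C) (hy₀c : yc ≤ y₀) (hy₀4 : Real.exp 4 ≤ y₀)
    (hy₀b : (κ + 1) * L * (1 - 1 / β) ^ (-κ - e) * R * c₀ * Real.log y₀ ^ (e - 1 / 2) ≤ 1)
    (hε : ε₁ + (κ + 1) * L * (1 - 1 / β) ^ (-κ - e) * R * Real.log y₀ ^ (-(1 / 2 : ℝ)) ≤ ε)
    {a : ℝ} (ha : 0 ≤ a) {N : ℕ}
    (hP0 : ∀ y z : ℝ, 2 ≤ z → z ^ β < y → Real.sqrt (Real.log y) ≤ Real.log z →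
      discT 0 g β y (primesProdBelow z) (N + 1) ≤
        vprod g (primesProdBelow z) * (Real.log y / Real.log z) ^ (-κ) *
          (contT 0 κ β (N + 1) (Real.log y / Real.log z) +
            a * C * Hm (Real.log y / Real.log z) * Real.log y ^ (-e))) :
    ∀ y z : ℝ, y₀ ≤ y → 2 ≤ z → z ^ (β + 1) ≤ y → Real.sqrt (Real.log y) ≤ Real.log z →
      discT 1 g β y (primesProdBelow z) (N + 2) ≤
        vprod g (primesProdBelow z) * (Real.log y / Real.log z) ^ (-κ) *
          (contT 1 κ β (N + 2) (Real.log y / Real.log z) +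
            (2 + (1 + ε) * a) * C * Hp (Real.log y / Real.log z) * Real.log y ^ (-e)) := by
  intro y z hy hz hzy hsz
  have hC0 : (0:ℝ) ≤ C := le_trans zero_le_one hC1
  have hy4 : Real.exp 4 ≤ y := hy₀4.trans hy
  obtain ⟨hy1, hly4, hs₀2, hss, hz₀2, hz₀z, hs0, hss₀⟩ := level_facts hy4 hz hsz
  set ly := Real.log y with hly
  set s₀ := Real.sqrt ly with hs₀def
  set z₀ := Real.exp s₀ with hz₀def
  set s := ly / Real.log z with hsdef
  have hlypos : 0 < ly := by linarith
  have hs₀0 : 0 < s₀ := by linarith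
  have hz1 : 1 < z := by linarith
  have hlogz : 0 < Real.log z := Real.log_pos hz1
  have hβ0 : 0 < β := by linarith
  have hy0 : 0 < y := by linarith
  -- `β + 1 ≤ s` from `z^{β+1} ≤ y`, and `z < y`
  have hβs : β + 1 ≤ s := by
    rw [hsdef, le_div_iff₀ hlogz, ← Real.log_rpow (by linarith)]
    exact Real.log_le_log (Real.rpow_pos_of_pos (by linarith) _) hzy
  have hs1 : 1 < s := by linarith
  have hzy' : z < y := by
    have : z < z ^ (β + 1) := by
      calc z = z ^ (1:ℝ) := (Real.rpow_one z).symm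
        _ < z ^ (β + 1) := Real.rpow_lt_rpow_of_exponent_lt hz1 (by linarith)
    linarith
  set V := vprod g (primesProdBelow z) with hVdef
  have hV : 0 < V := hdim.vprod_pos z
  have hbβ0 : 0 < 1 - 1 / β := one_sub_inv_pos hβ
  set bβ := (1 - 1 / β) ^ (-κ - e) with hbβ
  have hbβpos : 0 < bβ := Real.rpow_pos_of_pos hbβ0 _
  set T := ly ^ (-e) with hT
  have hT0 : 0 < T := Real.rpow_pos_of_pos hlypos _
  have hHm := (hHpos s).1
  -- (1) decomposition at `z₀`; the first upper sums vanish (`z^{β+1} ≤ y`) resp. are nonnegative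
  have hident := discT_one_succ_succ_sub hg β y hz₀z N
  have hT1z : bdrySum 1 g β y (primesProdBelow z) 1 = 0 := by
    rw [bdrySum_one_eq]
    refine Finset.sum_eq_zero fun p hp => if_neg ?_
    rintro ⟨-, hle⟩
    have hpz : (p : ℝ) < z := Nat.lt_ceil.mp (Nat.lt_of_mem_primesBelow hp)
    have hp0 : (0 : ℝ) ≤ p := Nat.cast_nonneg p
    have : (p : ℝ) ^ (β + 1) < z ^ (β + 1) := Real.rpow_lt_rpow hp0 hpz (by linarith)
    linarith
  have hT1z₀ : 0 ≤ bdrySum 1 g β y (primesProdBelow z₀) 1 :=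
    bdrySum_nonneg hg (squarefree_primesProdBelow z₀)
      (fun p hp => ⟨(hdim.1 p (Nat.prime_of_mem_primeFactors hp)).1,
        (hdim.1 p (Nat.prime_of_mem_primeFactors hp)).2.le⟩) 1 β y 1
  -- (2) the truncated part
  have htrunc : discT 1 g β y (primesProdBelow z₀) (N + 2) ≤ Ccr * (1 + L) * (V * s ^ (-κ) * (Hp s * T)) := by
    have hcr := hcrude y (hy₀c.trans hy) 1 (N + 2)
    have hV₀ := vprod_exp_sqrt_le hdim hy4 hz hsz
    have hV₀pos : 0 < vprod g (primesProdBelow z₀) := hdim.vprod_pos z₀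
    have h1 : Ccr * vprod g (primesProdBelow z₀) * s₀ ^ (-κ) * Real.exp (-s₀) * T ≤
        Ccr * ((s₀ / s) ^ κ * (1 + L / s₀) * V) * s₀ ^ (-κ) * Real.exp (-s₀) * T :=
      mul_le_mul_of_nonneg_right (mul_le_mul_of_nonneg_right (mul_le_mul_of_nonneg_right
        (mul_le_mul_of_nonneg_left hV₀ hCcr) (Real.rpow_nonneg hs₀0.le _)) (Real.exp_pos _).le) hT0.le
    have h2 : (s₀ / s) ^ κ * (1 + L / s₀) * V * s₀ ^ (-κ) = (1 + L / s₀) * (V * s ^ (-κ)) := by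
      rw [← div_rpow_mul_rpow_neg hs0 hs₀0 κ]; ring
    have h3 : 1 + L / s₀ ≤ 1 + L := by
      have : L / s₀ ≤ L / 1 := div_le_div_of_nonneg_left hL one_pos (by linarith)
      rw [div_one] at this; linarith
    have h4 : Real.exp (-s₀) ≤ Hp s := (Real.exp_le_exp.mpr (neg_le_neg hss₀)).trans (hH6 s)
    calc discT 1 g β y (primesProdBelow z₀) (N + 2)
        ≤ Ccr * vprod g (primesProdBelow z₀) * s₀ ^ (-κ) * Real.exp (-s₀) * T := hcr
      _ ≤ Ccr * ((s₀ / s) ^ κ * (1 + L / s₀) * V) * s₀ ^ (-κ) * Real.exp (-s₀) * T := h1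
      _ = Ccr * (1 + L / s₀) * (V * s ^ (-κ)) * Real.exp (-s₀) * T := by
          rw [show Ccr * ((s₀ / s) ^ κ * (1 + L / s₀) * V) * s₀ ^ (-κ) =
            Ccr * ((s₀ / s) ^ κ * (1 + L / s₀) * V * s₀ ^ (-κ)) by ring, h2]; ring
      _ ≤ Ccr * (1 + L) * (V * s ^ (-κ)) * Hp s * T := by
          have hVs : 0 ≤ V * s ^ (-κ) := mul_nonneg hV.le (Real.rpow_nonneg hs0.le _)
          refine mul_le_mul_of_nonneg_right (mul_le_mul (mul_le_mul_of_nonneg_right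
            (mul_le_mul_of_nonneg_left h3 hCcr) hVs) h4 (Real.exp_pos _).le ?_) hT0.le
          exact mul_nonneg (mul_nonneg hCcr (by linarith)) hVs
      _ = Ccr * (1 + L) * (V * s ^ (-κ) * (Hp s * T)) := by ring
  -- (3) the peeled primes: the weight function `Φ`
  set Φ : ℝ → ℝ := fun t => (1 - 1 / t) ^ (-κ) * contT 0 κ β (N + 1) (t - 1) +
    a * C * T * ((1 - 1 / t) ^ (-κ - e) * Hm (t - 1)) with hΦdef
  have haCT : 0 ≤ a * C * T := mul_nonneg (mul_nonneg ha hC0) hT0.le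
  have hΦ0 : ∀ t, 1 < t → 0 ≤ Φ t := by
    intro t ht
    have h1 : 0 ≤ (1 - 1 / t) ^ (-κ) := Real.rpow_nonneg (one_sub_inv_pos ht).le _
    have h2 : 0 ≤ (1 - 1 / t) ^ (-κ - e) := Real.rpow_nonneg (one_sub_inv_pos ht).le _
    have h3 : 0 ≤ contT 0 κ β (N + 1) (t - 1) := contT_nonneg hκ.le hβ.le 0 (N + 1) (by linarith)
    have h4 := (hHpos (t - 1)).2.le
    simp only [hΦdef]
    exact add_nonneg (mul_nonneg h1 h3) (mul_nonneg haCT (mul_nonneg h2 h4))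
  have hΦm : AntitoneOn Φ (Icc s s₀) := by
    intro t ht t' ht' htt'
    have ht1 : 1 < t := by linarith [ht.1]
    have ht'1 : 1 < t' := by linarith [ht'.1]
    simp only [hΦdef]
    refine add_le_add ?_ (mul_le_mul_of_nonneg_left ?_ haCT)
    · refine mul_le_mul (one_sub_inv_rpow_antitone (by linarith) ht1 htt')
        (contT_antitoneOn hκ.le hβ 0 (N + 1) (show (0:ℝ) ≤ t - 1 by linarith)
          (show (0:ℝ) ≤ t' - 1 by linarith) (by linarith))
        (contT_nonneg hκ.le hβ.le 0 (N + 1) (by linarith)) (Real.rpow_nonneg (one_sub_inv_pos ht1).le _)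
    · refine mul_le_mul (one_sub_inv_rpow_antitone (by linarith) ht1 htt') (hHm_anti (by linarith))
        (hHpos _).2.le (Real.rpow_nonneg (one_sub_inv_pos ht1).le _)
  have hΦc : ContinuousOn Φ (Icc s s₀) := by
    have hbase : ∀ r : ℝ, ContinuousOn (fun t : ℝ => (1 - 1 / t) ^ r) (Icc s s₀) := by
      intro r t ht
      have ht1 : 1 < t := by linarith [ht.1]
      exact ((continuousAt_const.sub (continuousAt_const.div continuousAt_id (ne_of_gt (show (0:ℝ) < id t by simp only [id]; linarith)))).rpow_const
        (Or.inl (one_sub_inv_pos ht1).ne')).continuousWithinAt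
    simp only [hΦdef]
    exact ((hbase (-κ)).mul ((continuous_contT hκ.le hβ 0 (N + 1)).comp
      (continuous_id.sub continuous_const)).continuousOn).add
      (continuousOn_const.mul ((hbase (-κ - e)).mul
        (hHm_cont.comp (continuous_id.sub continuous_const)).continuousOn))
  -- (3a) pointwise insertion of the inductive bound
  have hpt : ∀ p ∈ (Nat.primesBelow ⌈z⌉₊).filter (fun p : ℕ => z₀ ≤ (p : ℝ)),
      (if (p : ℝ) ^ (β + 1) < y then g p else 0) * discT 0 g β (y / p) (primesProdBelow p) (N + 1) ≤
        s ^ (-κ) * (g p * vprod g (primesProdBelow p) * ((Real.log p / Real.log z) ^ κ * Φ (ly / Real.log p))) := by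
    intro p hp
    rw [Finset.mem_filter, Nat.mem_primesBelow] at hp
    obtain ⟨⟨hpz, hpp⟩, hz₀p⟩ := hp
    have hpzR : (p : ℝ) < z := Nat.lt_ceil.mp hpz
    have hp2 : (2 : ℝ) ≤ p := hz₀2.trans hz₀p
    have hp1 : (1 : ℝ) < p := by linarith
    have hp0 : (0 : ℝ) < p := by linarith
    have hpy : (p : ℝ) < y := hpzR.trans hzy'
    have hlogp : 0 < Real.log p := Real.log_pos hp1
    have hlogpz : Real.log p < Real.log z := Real.log_lt_log hp0 hpzR
    have hlogps₀ : s₀ ≤ Real.log p := by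
      have := Real.log_le_log (by linarith : (0:ℝ) < z₀) hz₀p
      rwa [hz₀def, Real.log_exp] at this
    set tp := ly / Real.log p with htp
    have htp_gt : s < tp := div_lt_div_of_pos_left hlypos hlogp hlogpz
    have htp_le : tp ≤ s₀ := by
      rw [htp, div_le_iff₀ hlogp]
      calc ly = s₀ * s₀ := hss.symm
        _ ≤ s₀ * Real.log p := mul_le_mul_of_nonneg_left hlogps₀ hs₀0.le
    have htp1 : 1 < tp := by linarith
    have htp0 : 0 < tp := by linarith
    -- the inductive bound at `(y/p, p)`
    have hpβ1 : (p : ℝ) ^ (β + 1) < y :=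
      lt_of_lt_of_le (Real.rpow_lt_rpow hp0.le hpzR (by linarith)) hzy
    have hcond2 : (p : ℝ) ^ β < y / p := by
      rw [lt_div_iff₀ hp0, ← Real.rpow_add_one hp0.ne']
      exact hpβ1
    have hlogyp : Real.log (y / p) = ly - Real.log p := Real.log_div hy0.ne' hp0.ne'
    have hlyp : ly - Real.log p = ly * (1 - 1 / tp) := by
      rw [htp]; field_simp
    have hcond3 : Real.sqrt (Real.log (y / p)) ≤ Real.log p := by
      rw [hlogyp, Real.sqrt_le_left hlogp.le]
      calc ly - Real.log p ≤ ly := by linarith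
        _ = s₀ * s₀ := hss.symm
        _ ≤ Real.log p * Real.log p := mul_le_mul hlogps₀ hlogps₀ hs₀0.le hlogp.le
        _ = Real.log p ^ 2 := (sq _).symm
    have hind := hP0 (y / p) p hp2 hcond2 hcond3
    rw [hlogyp] at hind
    have hs' : (ly - Real.log p) / Real.log p = tp - 1 := by rw [htp]; field_simp
    rw [hs'] at hind
    -- normalisations
    have hnorm := rpow_neg_log_div_log_sub_one hy1 hz1 hp1 hpy κ
    rw [← htp, ← hsdef] at hnorm
    have hbase0 : 0 ≤ 1 - 1 / tp := (one_sub_inv_pos htp1).le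
    have hloge : (ly - Real.log p) ^ (-e) = T * (1 - 1 / tp) ^ (-e) := by
      rw [hlyp, Real.mul_rpow hlypos.le hbase0]
    rw [hnorm, hloge] at hind
    have hgp : 0 ≤ g p := (hdim.1 p hpp).1
    have hkey : vprod g (primesProdBelow p) * ((Real.log p / Real.log z) ^ κ * s ^ (-κ) * (1 - 1 / tp) ^ (-κ)) *
        (contT 0 κ β (N + 1) (tp - 1) + a * C * Hm (tp - 1) * (T * (1 - 1 / tp) ^ (-e))) =
        s ^ (-κ) * (vprod g (primesProdBelow p) * ((Real.log p / Real.log z) ^ κ * Φ tp)) := by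
      simp only [hΦdef]
      rw [show (-κ - e : ℝ) = -κ + -e by ring, Real.rpow_add (one_sub_inv_pos htp1)]
      ring
    have hW0 : 0 ≤ discT 0 g β (y / p) (primesProdBelow p) (N + 1) :=
      discT_nonneg hg (squarefree_primesProdBelow _)
        (fun q hq => ⟨(hdim.1 q (Nat.prime_of_mem_primeFactors hq)).1,
          (hdim.1 q (Nat.prime_of_mem_primeFactors hq)).2.le⟩) 0 β (y / p) (N + 1)
    rw [if_pos hpβ1]
    calc g p * discT 0 g β (y / p) (primesProdBelow p) (N + 1)
        ≤ g p * (vprod g (primesProdBelow p) * ((Real.log p / Real.log z) ^ κ * s ^ (-κ) * (1 - 1 / tp) ^ (-κ)) *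
            (contT 0 κ β (N + 1) (tp - 1) + a * C * Hm (tp - 1) * (T * (1 - 1 / tp) ^ (-e)))) :=
          mul_le_mul_of_nonneg_left hind hgp
      _ = s ^ (-κ) * (g p * vprod g (primesProdBelow p) * ((Real.log p / Real.log z) ^ κ * Φ tp)) := by
          rw [hkey]; ring
  -- (3b) partial summation
  have hsum0 : ∑ p ∈ (Nat.primesBelow ⌈z⌉₊).filter (fun p : ℕ => z₀ ≤ (p : ℝ)),
      (if (p : ℝ) ^ (β + 1) < y then g p else 0) * discT 0 g β (y / p) (primesProdBelow p) (N + 1) ≤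
      s ^ (-κ) * (V * (κ * (∫ t in s..s₀, Φ t / t) + Φ s * ((κ + 1) * L / s₀))) := by
    have hlogz₀' : Real.log z₀ = s₀ := by rw [hz₀def, Real.log_exp]
    have hlys₀ : ly / s₀ = s₀ := by rw [div_eq_iff hs₀0.ne']; exact hss.symm
    have h21 := sum_peeled_le hdim hκ.le hy1 hz₀2 hz₀z (Φ := Φ)
      (fun t ht => hΦ0 t (by rw [← hsdef] at ht; linarith [ht.1]))
      (by rw [← hsdef, hlogz₀', hlys₀]; exact hΦm)
      (by rw [← hsdef, hlogz₀', hlys₀]; exact hΦc)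
    rw [← hsdef, hlogz₀', hlys₀] at h21
    calc ∑ p ∈ (Nat.primesBelow ⌈z⌉₊).filter (fun p : ℕ => z₀ ≤ (p : ℝ)),
          (if (p : ℝ) ^ (β + 1) < y then g p else 0) * discT 0 g β (y / p) (primesProdBelow p) (N + 1)
        ≤ ∑ p ∈ (Nat.primesBelow ⌈z⌉₊).filter (fun p : ℕ => z₀ ≤ (p : ℝ)),
            s ^ (-κ) * (g p * vprod g (primesProdBelow p) * ((Real.log p / Real.log z) ^ κ * Φ (ly / Real.log p))) :=
          Finset.sum_le_sum hpt
      _ = s ^ (-κ) * ∑ p ∈ (Nat.primesBelow ⌈z⌉₊).filter (fun p : ℕ => z₀ ≤ (p : ℝ)),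
            g p * vprod g (primesProdBelow p) * ((Real.log p / Real.log z) ^ κ * Φ (ly / Real.log p)) := by
          rw [Finset.mul_sum]
      _ ≤ s ^ (-κ) * (V * (κ * (∫ t in s..s₀, Φ t / t) + Φ s * ((κ + 1) * L / s₀))) :=
          mul_le_mul_of_nonneg_left h21 (Real.rpow_nonneg hs0.le _)
  -- (3c) the integral: main part and `H`-part
  have hint_eval : κ * (∫ t in s..s₀, Φ t / t) =
      (∫ t in s..s₀, sieveKernel κ t * contT 0 κ β (N + 1) (t - 1)) +
        a * C * T * ∫ t in s..s₀, sieveKernel κ t * (1 - 1 / t) ^ (-e) * Hm (t - 1) := by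
    have hi1 : IntervalIntegrable (fun t => sieveKernel κ t * contT 0 κ β (N + 1) (t - 1)) volume s s₀ :=
      intervalIntegrable_sieveKernel_mul (continuous_contT hκ.le hβ 0 (N + 1)) hs1 hss₀
    have hi2 : IntervalIntegrable (fun t => sieveKernel κ t * (1 - 1 / t) ^ (-e) * Hm (t - 1)) volume s s₀ := by
      refine ContinuousOn.intervalIntegrable ?_
      rw [uIcc_of_le hss₀]
      exact ((continuousOn_sieveKernel_mul_rpow κ e).mono fun t ht => show (1:ℝ) < t by linarith [ht.1]).mul
        (hHm_cont.comp (continuous_id.sub continuous_const)).continuousOn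
    rw [← intervalIntegral.integral_const_mul, ← intervalIntegral.integral_const_mul,
      ← intervalIntegral.integral_add hi1 (hi2.const_mul _)]
    refine intervalIntegral.integral_congr fun t ht => ?_
    rw [uIcc_of_le hss₀] at ht
    have ht1 : 1 < t := by linarith [ht.1]
    have ht0 : (0:ℝ) < t := by linarith
    simp only [hΦdef]
    rw [sieveKernel_mul_rpow_eq ht1, sieveKernel_eq_of_one_lt ht1]
    field_simp
  have hmain : ∫ t in s..s₀, sieveKernel κ t * contT 0 κ β (N + 1) (t - 1) ≤ contT 1 κ β (N + 2) s := by
    rw [← contT_one_sub_eq_integral hκ.le hβ N hβs hss₀]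
    linarith [contT_nonneg hκ.le hβ.le 1 (N + 2) (show (0:ℝ) ≤ s₀ by linarith)]
  have hHpart : ∫ t in s..s₀, sieveKernel κ t * (1 - 1 / t) ^ (-e) * Hm (t - 1) ≤ (1 + ε₁) * Hp s :=
    hH2 s s₀ hβs hss₀
  -- (3d) the boundary term
  have hbdry : Φ s ≤ bβ * (c₀ + a * C * T) * (R * Hp s) := by
    have h1 : (1 - 1 / s) ^ (-κ) ≤ (1 - 1 / s) ^ (-κ - e) := one_sub_inv_rpow_le_rpow he0 hs1
    have h2 : (1 - 1 / s) ^ (-κ - e) ≤ bβ := one_sub_inv_rpow_le (by linarith) hβ (by linarith)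
    have h3 : contT 0 κ β (N + 1) (s - 1) ≤ c₀ * Hm (s - 1) := hH4 (N + 1) (s - 1) (by linarith)
    have h4 : Hm (s - 1) ≤ R * Hp s := hH3 s hβs
    have hT1 : 0 ≤ contT 0 κ β (N + 1) (s - 1) := contT_nonneg hκ.le hβ.le 0 (N + 1) (by linarith)
    have hHp0 := (hHpos (s - 1)).2.le
    have hr0 : 0 ≤ (1 - 1 / s) ^ (-κ) := Real.rpow_nonneg (one_sub_inv_pos hs1).le _
    simp only [hΦdef]
    calc (1 - 1 / s) ^ (-κ) * contT 0 κ β (N + 1) (s - 1) + a * C * T * ((1 - 1 / s) ^ (-κ - e) * Hm (s - 1))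
        ≤ bβ * (c₀ * Hm (s - 1)) + a * C * T * (bβ * Hm (s - 1)) :=
          add_le_add (mul_le_mul (h1.trans h2) h3 hT1 hbβpos.le)
            (mul_le_mul_of_nonneg_left (mul_le_mul_of_nonneg_right h2 hHp0) haCT)
      _ = bβ * (c₀ + a * C * T) * Hm (s - 1) := by ring
      _ ≤ bβ * (c₀ + a * C * T) * (R * Hp s) :=
          mul_le_mul_of_nonneg_left h4 (mul_nonneg hbβpos.le (add_nonneg hc₀ haCT))
  -- (4) assembly of the error terms
  have hly₀le : Real.log y₀ ≤ ly := Real.log_le_log (by linarith [Real.add_one_le_exp (4:ℝ)]) hy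
  have hly₀pos : 0 < Real.log y₀ := by
    have : (4:ℝ) ≤ Real.log y₀ := by
      rw [Real.le_log_iff_exp_le (by linarith [Real.add_one_le_exp (4:ℝ)])]; exact hy₀4
    linarith
  have hs₀inv : 1 / s₀ = ly ^ (-(1 / 2 : ℝ)) := by
    rw [hs₀def, Real.sqrt_eq_rpow, Real.rpow_neg hlypos.le, one_div]
  have hs₀T : (κ + 1) * L * bβ * R * c₀ / s₀ ≤ C * T := by
    have hmono : ly ^ (e - 1 / 2) ≤ Real.log y₀ ^ (e - 1 / 2) :=
      Real.rpow_le_rpow_of_nonpos hly₀pos hly₀le (by linarith)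
    have h1 : (κ + 1) * L * bβ * R * c₀ * ly ^ (e - 1 / 2) ≤ 1 :=
      le_trans (mul_le_mul_of_nonneg_left hmono
        (mul_nonneg (mul_nonneg (mul_nonneg (mul_nonneg (by linarith) hL) hbβpos.le) hR) hc₀)) hy₀b
    have hsplit : 1 / s₀ = ly ^ (e - 1 / 2) * T := by
      rw [hs₀inv, hT, ← Real.rpow_add hlypos]; ring_nf
    have hdiv : (κ + 1) * L * bβ * R * c₀ / s₀ = ((κ + 1) * L * bβ * R * c₀) * (1 / s₀) := by ring
    calc (κ + 1) * L * bβ * R * c₀ / s₀ = ((κ + 1) * L * bβ * R * c₀) * (ly ^ (e - 1 / 2) * T) := by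
          rw [hdiv, hsplit]
      _ = ((κ + 1) * L * bβ * R * c₀ * ly ^ (e - 1 / 2)) * T := by ring
      _ ≤ 1 * T := mul_le_mul_of_nonneg_right h1 hT0.le
      _ ≤ C * T := mul_le_mul_of_nonneg_right hC1 hT0.le
  have hεT : ε₁ + (κ + 1) * L * bβ * R / s₀ ≤ ε := by
    have hmono : ly ^ (-(1 / 2 : ℝ)) ≤ Real.log y₀ ^ (-(1 / 2 : ℝ)) :=
      Real.rpow_le_rpow_of_nonpos hly₀pos hly₀le (by norm_num)
    have : (κ + 1) * L * bβ * R / s₀ ≤ (κ + 1) * L * bβ * R * Real.log y₀ ^ (-(1 / 2 : ℝ)) := by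
      rw [div_eq_mul_one_div, hs₀inv]
      exact mul_le_mul_of_nonneg_left hmono (mul_nonneg (mul_nonneg (mul_nonneg (by linarith) hL) hbβpos.le) hR)
    linarith
  -- final combination
  have hsum := hsum0
  rw [hint_eval] at hsum
  have hE : V * (((∫ t in s..s₀, sieveKernel κ t * contT 0 κ β (N + 1) (t - 1)) +
        a * C * T * ∫ t in s..s₀, sieveKernel κ t * (1 - 1 / t) ^ (-e) * Hm (t - 1)) +
        Φ s * ((κ + 1) * L / s₀)) ≤
      V * (contT 1 κ β (N + 2) s + (a * C * T * (1 + ε₁) + (κ + 1) * L * bβ * R * (c₀ + a * C * T) / s₀) * Hp s) := by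
    refine mul_le_mul_of_nonneg_left ?_ hV.le
    have h1 : a * C * T * (∫ t in s..s₀, sieveKernel κ t * (1 - 1 / t) ^ (-e) * Hm (t - 1)) ≤
        a * C * T * ((1 + ε₁) * Hp s) := mul_le_mul_of_nonneg_left hHpart haCT
    have h2 : Φ s * ((κ + 1) * L / s₀) ≤ bβ * (c₀ + a * C * T) * (R * Hp s) * ((κ + 1) * L / s₀) :=
      mul_le_mul_of_nonneg_right hbdry (div_nonneg (mul_nonneg (by linarith) hL) hs₀0.le)
    have h3 : bβ * (c₀ + a * C * T) * (R * Hp s) * ((κ + 1) * L / s₀) =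
        (κ + 1) * L * bβ * R * (c₀ + a * C * T) / s₀ * Hp s := by ring
    linarith [h1, h2, h3, hmain]
  have hcoef : Ccr * (1 + L) * T + (a * C * T * (1 + ε₁) + (κ + 1) * L * bβ * R * (c₀ + a * C * T) / s₀) ≤
      (2 + (1 + ε) * a) * C * T := by
    have h1 : Ccr * (1 + L) * T ≤ C * T := mul_le_mul_of_nonneg_right hC2 hT0.le
    have h2 : (κ + 1) * L * bβ * R * (c₀ + a * C * T) / s₀ =
        (κ + 1) * L * bβ * R * c₀ / s₀ + ((κ + 1) * L * bβ * R / s₀) * (a * C * T) := by ring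
    have h3 : ((κ + 1) * L * bβ * R / s₀) * (a * C * T) ≤ (ε - ε₁) * (a * C * T) :=
      mul_le_mul_of_nonneg_right (by linarith) haCT
    rw [h2]
    linarith [h1, hs₀T, h3]
  calc discT 1 g β y (primesProdBelow z) (N + 2)
      ≤ discT 1 g β y (primesProdBelow z₀) (N + 2) +
          ∑ p ∈ (Nat.primesBelow ⌈z⌉₊).filter (fun p : ℕ => z₀ ≤ (p : ℝ)),
            (if (p : ℝ) ^ (β + 1) < y then g p else 0) * discT 0 g β (y / p) (primesProdBelow p) (N + 1) := by
        linarith [hident, hT1z, hT1z₀]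
    _ ≤ Ccr * (1 + L) * (V * s ^ (-κ) * (Hp s * T)) +
          s ^ (-κ) * (V * (contT 1 κ β (N + 2) s +
            (a * C * T * (1 + ε₁) + (κ + 1) * L * bβ * R * (c₀ + a * C * T) / s₀) * Hp s)) := by
        have := mul_le_mul_of_nonneg_left hE (Real.rpow_nonneg hs0.le (-κ))
        linarith [htrunc, hsum]
    _ = V * s ^ (-κ) * (contT 1 κ β (N + 2) s +
          (Ccr * (1 + L) * T + (a * C * T * (1 + ε₁) + (κ + 1) * L * bβ * R * (c₀ + a * C * T) / s₀)) * Hp s) := by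
        ring
    _ ≤ V * s ^ (-κ) * (contT 1 κ β (N + 2) s + (2 + (1 + ε) * a) * C * T * Hp s) :=
        mul_le_mul_of_nonneg_left (by linarith [mul_le_mul_of_nonneg_right hcoef hHm.le])
          (mul_nonneg hV.le (Real.rpow_nonneg hs0.le _))
    _ = V * s ^ (-κ) * (contT 1 κ β (N + 2) s + (2 + (1 + ε) * a) * C * Hp s * T) := by ring

/-! ### The upper-parity step in the range `β − 1 < s < β + 1` ((4.6) and (8.3)) -/

/-- **The upper bound below `β + 1`** (Iwaniec (4.6) with (8.3) and the third line of (7.3)): if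
`T⁺_N(y, P(z))` obeys the inductive bound with amplitude `a` whenever `z^{β+1} ≤ y` (for the levels
`y ≥ y₀`), then for `z^{β−1} < y < z^{β+1}` it obeys it with amplitude `1 + (1 + ε) a`:
`T⁺_N(y, P(z)) = T⁺_1(y, P(z)) + T⁺_N(y, P(y^{1/(β+1)}))`, the first term is at most
`V s^{−κ}{(β + 1)^κ − s^κ + L(β + 1)^{κ+1}/log y}`, the second is the case `s = β + 1`, and
`T⁺_N(s) = (β + 1)^κ − s^κ + T⁺_N(β + 1)`. [cite: IwaniecActaArith1980, (4.6), (8.3) and (7.3)] -/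
theorem step_one_low {L e c₀ : ℝ} {Hp : ℝ → ℝ} {g : ArithmeticFunction ℝ}
    (hκ : 0 < κ) (hβ : 1 < β) (hL : 0 ≤ L) (he1 : e ≤ 1) (hc₀ : 0 ≤ c₀)
    (hHpos : ∀ s, 0 < Hp s) (hHp_anti : Antitone Hp)
    (hH4 : ∀ (N : ℕ) (u : ℝ), β - 1 ≤ u → contT 1 κ β N u ≤ c₀ * Hp u)
    (hg : g.IsMultiplicative) (hdim : HasIwaniecDimension g κ L)
    {C ε y₀ : ℝ} (hC1 : 1 ≤ C) (hε0 : 0 ≤ ε) (hy₀4 : Real.exp 4 ≤ y₀) (hy₀5 : (β + 1) ^ 2 ≤ Real.log y₀)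
    (hy₀6 : L * (β + 1) ^ (κ + 1) * Real.log y₀ ^ (e - 1) ≤ Hp (β + 1) / 2)
    (hy₀7 : L * (β + 1) * c₀ * Real.log y₀ ^ (e - 1) ≤ 1 / 2)
    (hε4 : L * (β + 1) / Real.log y₀ ≤ ε)
    {a : ℝ} (ha : 0 ≤ a) {N : ℕ} (hN : 1 ≤ N)
    (hHigh : ∀ y z : ℝ, y₀ ≤ y → 2 ≤ z → z ^ (β + 1) ≤ y → Real.sqrt (Real.log y) ≤ Real.log z →
      discT 1 g β y (primesProdBelow z) N ≤
        vprod g (primesProdBelow z) * (Real.log y / Real.log z) ^ (-κ) *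
          (contT 1 κ β N (Real.log y / Real.log z) + a * C * Hp (Real.log y / Real.log z) * Real.log y ^ (-e))) :
    ∀ y z : ℝ, y₀ ≤ y → 2 ≤ z → z ^ (β - 1) < y → y < z ^ (β + 1) →
      discT 1 g β y (primesProdBelow z) N ≤
        vprod g (primesProdBelow z) * (Real.log y / Real.log z) ^ (-κ) *
          (contT 1 κ β N (Real.log y / Real.log z) +
            (1 + (1 + ε) * a) * C * Hp (Real.log y / Real.log z) * Real.log y ^ (-e)) := by
  intro y z hy hz hzy hyz
  have hC0 : (0:ℝ) ≤ C := le_trans zero_le_one hC1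
  have hy4 : Real.exp 4 ≤ y := hy₀4.trans hy
  have hy1 : 1 < y := by linarith [Real.add_one_le_exp (4:ℝ)]
  have hy0 : 0 < y := by linarith
  have hy₀0 : 0 < y₀ := by linarith [Real.add_one_le_exp (4:ℝ)]
  have hlogy4 : 4 ≤ Real.log y := by rw [Real.le_log_iff_exp_le hy0]; exact hy4
  set ly := Real.log y with hly
  have hlypos : 0 < ly := by linarith
  have hly₀le : Real.log y₀ ≤ ly := Real.log_le_log hy₀0 hy
  have hβ1 : 0 < β + 1 := by linarith
  have hly₀pos : 0 < Real.log y₀ := lt_of_lt_of_le (pow_pos hβ1 2) hy₀5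
  have hlyβ : (β + 1) ^ 2 ≤ ly := hy₀5.trans hly₀le
  have hz1 : 1 < z := by linarith
  have hz0 : 0 < z := by linarith
  have hlogz : 0 < Real.log z := Real.log_pos hz1
  set s := ly / Real.log z with hsdef
  have hs0 : 0 < s := div_pos hlypos hlogz
  have hsβ : s < β + 1 := by
    rw [hsdef, div_lt_iff₀ hlogz, ← Real.log_rpow hz0]
    exact Real.log_lt_log hy0 hyz
  -- `z₁ = y^{1/(β+1)}`
  set z₁ := y ^ (1 / (β + 1)) with hz₁def
  have hlogz₁ : Real.log z₁ = ly / (β + 1) := by rw [hz₁def, Real.log_rpow hy0]; ring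
  have hz₁pos : 0 < z₁ := Real.rpow_pos_of_pos hy0 _
  have hlogz₁ge : β + 1 ≤ Real.log z₁ := by
    rw [hlogz₁, le_div_iff₀ hβ1]; nlinarith
  have hz₁2 : 2 ≤ z₁ := by
    have h2 : (2:ℝ) ≤ Real.exp 2 := by linarith [Real.add_one_le_exp (2:ℝ)]
    calc (2:ℝ) ≤ Real.exp 2 := h2
      _ ≤ Real.exp (Real.log z₁) := Real.exp_le_exp.mpr (by linarith)
      _ = z₁ := Real.exp_log hz₁pos
  have hz₁z : z₁ ≤ z := by
    have h := Real.rpow_le_rpow hy0.le hyz.le (one_div_nonneg.mpr hβ1.le)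
    rw [one_div, Real.rpow_rpow_inv hz0.le hβ1.ne'] at h
    show y ^ (1 / (β + 1)) ≤ z
    rw [one_div]; exact h
  have hz₁y : z₁ ^ (β + 1) = y := by
    rw [hz₁def, one_div, Real.rpow_inv_rpow hy0.le hβ1.ne']
  have hsqrt : Real.sqrt ly ≤ Real.log z₁ := by
    rw [Real.sqrt_le_left (by linarith)]
    calc ly = (β + 1) * (ly / (β + 1)) := by field_simp
      _ ≤ Real.log z₁ * Real.log z₁ := by rw [← hlogz₁]; exact mul_le_mul_of_nonneg_right hlogz₁ge (by linarith)
      _ = Real.log z₁ ^ 2 := (sq _).symm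
  -- the decomposition (4.6) and the two bounds
  have hsplit := discT_one_eq_add hg hy0.le hβ1 hz₁z hN
  have hT1 := bdrySum_one_one_le hdim hy0 hβ1 hz₁2 hz₁z
  rw [← hly, ← hsdef] at hT1
  have hhigh := hHigh y z₁ hy hz₁2 hz₁y.le hsqrt
  have hsz₁ : ly / Real.log z₁ = β + 1 := by rw [hlogz₁]; field_simp
  rw [hsz₁] at hhigh
  set V := vprod g (primesProdBelow z) with hVdef
  have hV : 0 < V := hdim.vprod_pos z
  have hV₁ := hdim.vprod_le hz₁2 hz₁z
  have hratio : Real.log z / Real.log z₁ = (β + 1) / s := by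
    rw [hlogz₁, hsdef]; field_simp
  rw [hratio, ← hVdef] at hV₁
  set T := ly ^ (-e) with hT
  have hT0 : 0 < T := Real.rpow_pos_of_pos hlypos _
  -- `V(z₁) (β+1)^{-κ} ≤ s^{-κ} (1 + L(β+1)/ly) V`
  have hV₁' : vprod g (primesProdBelow z₁) * (β + 1) ^ (-κ) ≤ (1 + L / Real.log z₁) * (V * s ^ (-κ)) := by
    have h := mul_le_mul_of_nonneg_right hV₁ (Real.rpow_nonneg hβ1.le (-κ))
    calc vprod g (primesProdBelow z₁) * (β + 1) ^ (-κ)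
        ≤ ((β + 1) / s) ^ κ * (1 + L / Real.log z₁) * V * (β + 1) ^ (-κ) := h
      _ = (1 + L / Real.log z₁) * (V * (((β + 1) / s) ^ κ * (β + 1) ^ (-κ))) := by ring
      _ = (1 + L / Real.log z₁) * (V * s ^ (-κ)) := by rw [div_rpow_mul_rpow_neg hs0 hβ1 κ]
  have hLz₁ : L / Real.log z₁ = L * (β + 1) / ly := by rw [hlogz₁]; field_simp
  rw [hLz₁] at hV₁'
  have hsmall : L * (β + 1) / ly ≤ ε := by
    calc L * (β + 1) / ly ≤ L * (β + 1) / Real.log y₀ :=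
          div_le_div_of_nonneg_left (mul_nonneg hL hβ1.le) hly₀pos hly₀le
      _ ≤ ε := hε4
  -- error bookkeeping
  have hHβ := hHpos (β + 1)
  have hHs : Hp (β + 1) ≤ Hp s := hHp_anti hsβ.le
  have hmono : ly ^ (e - 1) ≤ Real.log y₀ ^ (e - 1) :=
    Real.rpow_le_rpow_of_nonpos hly₀pos hly₀le (by linarith)
  have hsplit_exp : 1 / ly = ly ^ (e - 1) * T := by
    rw [hT, ← Real.rpow_add hlypos, one_div, ← Real.rpow_neg_one]; ring_nf
  have herr1 : L * (β + 1) ^ (κ + 1) / ly ≤ 1 / 2 * C * Hp (β + 1) * T := by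
    have h1 : L * (β + 1) ^ (κ + 1) * ly ^ (e - 1) ≤ Hp (β + 1) / 2 :=
      le_trans (mul_le_mul_of_nonneg_left hmono (mul_nonneg hL (Real.rpow_nonneg hβ1.le _))) hy₀6
    calc L * (β + 1) ^ (κ + 1) / ly = (L * (β + 1) ^ (κ + 1) * ly ^ (e - 1)) * T := by
          rw [div_eq_mul_one_div, hsplit_exp]; ring
      _ ≤ Hp (β + 1) / 2 * T := mul_le_mul_of_nonneg_right h1 hT0.le
      _ = 1 / 2 * 1 * Hp (β + 1) * T := by ring
      _ ≤ 1 / 2 * C * Hp (β + 1) * T :=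
          mul_le_mul_of_nonneg_right (mul_le_mul_of_nonneg_right
            (mul_le_mul_of_nonneg_left hC1 (by norm_num)) hHβ.le) hT0.le
  have herr2 : L * (β + 1) / ly * contT 1 κ β N (β + 1) ≤ 1 / 2 * C * Hp (β + 1) * T := by
    have h1 : L * (β + 1) * c₀ * ly ^ (e - 1) ≤ 1 / 2 :=
      le_trans (mul_le_mul_of_nonneg_left hmono (mul_nonneg (mul_nonneg hL hβ1.le) hc₀)) hy₀7
    have h2 : contT 1 κ β N (β + 1) ≤ c₀ * Hp (β + 1) := hH4 N (β + 1) (by linarith)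
    have h3 : 0 ≤ L * (β + 1) / ly := div_nonneg (mul_nonneg hL hβ1.le) hlypos.le
    calc L * (β + 1) / ly * contT 1 κ β N (β + 1) ≤ L * (β + 1) / ly * (c₀ * Hp (β + 1)) :=
          mul_le_mul_of_nonneg_left h2 h3
      _ = (L * (β + 1) * c₀ * ly ^ (e - 1)) * Hp (β + 1) * T := by
          rw [div_eq_mul_one_div, hsplit_exp]; ring
      _ ≤ 1 / 2 * Hp (β + 1) * T :=
          mul_le_mul_of_nonneg_right (mul_le_mul_of_nonneg_right h1 hHβ.le) hT0.le
      _ = 1 / 2 * 1 * Hp (β + 1) * T := by ring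
      _ ≤ 1 / 2 * C * Hp (β + 1) * T :=
          mul_le_mul_of_nonneg_right (mul_le_mul_of_nonneg_right
            (mul_le_mul_of_nonneg_left hC1 (by norm_num)) hHβ.le) hT0.le
  have herr3 : (1 + L * (β + 1) / ly) * (a * C * Hp (β + 1) * T) ≤ (1 + ε) * (a * C * Hp (β + 1) * T) :=
    mul_le_mul_of_nonneg_right (by linarith) (mul_nonneg (mul_nonneg (mul_nonneg ha hC0) hHβ.le) hT0.le)
  have hcontT := contT_one_eq_of_le (κ := κ) hN hsβ.le
  -- assembly
  have hhigh' : discT 1 g β y (primesProdBelow z₁) N ≤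
      (1 + L * (β + 1) / ly) * (V * s ^ (-κ)) * (contT 1 κ β N (β + 1) + a * C * Hp (β + 1) * T) := by
    refine hhigh.trans ?_
    have h0 : 0 ≤ contT 1 κ β N (β + 1) + a * C * Hp (β + 1) * T :=
      add_nonneg (contT_nonneg hκ.le hβ.le 1 N (by linarith : (0:ℝ) ≤ β + 1))
        (mul_nonneg (mul_nonneg (mul_nonneg ha hC0) hHβ.le) hT0.le)
    exact mul_le_mul_of_nonneg_right hV₁' h0
  have hVs : 0 ≤ V * s ^ (-κ) := mul_nonneg hV.le (Real.rpow_nonneg hs0.le _)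
  have hT1' : bdrySum 1 g β y (primesProdBelow z) 1 ≤
      V * s ^ (-κ) * ((β + 1) ^ κ - s ^ κ + L * (β + 1) ^ (κ + 1) / ly) := hT1
  have hcT0 : 0 ≤ contT 1 κ β N (β + 1) := contT_nonneg hκ.le hβ.le 1 N (by linarith)
  calc discT 1 g β y (primesProdBelow z) N
      = bdrySum 1 g β y (primesProdBelow z) 1 + discT 1 g β y (primesProdBelow z₁) N := hsplit
    _ ≤ V * s ^ (-κ) * ((β + 1) ^ κ - s ^ κ + L * (β + 1) ^ (κ + 1) / ly) +
          (1 + L * (β + 1) / ly) * (V * s ^ (-κ)) * (contT 1 κ β N (β + 1) + a * C * Hp (β + 1) * T) :=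
        add_le_add hT1' hhigh'
    _ = V * s ^ (-κ) * (((β + 1) ^ κ - s ^ κ + contT 1 κ β N (β + 1)) +
          (L * (β + 1) ^ (κ + 1) / ly + L * (β + 1) / ly * contT 1 κ β N (β + 1) +
            (1 + L * (β + 1) / ly) * (a * C * Hp (β + 1) * T))) := by ring
    _ ≤ V * s ^ (-κ) * (contT 1 κ β N s + (1 + (1 + ε) * a) * C * Hp s * T) := by
        refine mul_le_mul_of_nonneg_left ?_ hVs
        rw [hcontT]
        have hsum : L * (β + 1) ^ (κ + 1) / ly + L * (β + 1) / ly * contT 1 κ β N (β + 1) +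
            (1 + L * (β + 1) / ly) * (a * C * Hp (β + 1) * T) ≤ (1 + (1 + ε) * a) * C * Hp (β + 1) * T := by
          linarith [herr1, herr2, herr3]
        have hpos1 : 0 ≤ (1 + (1 + ε) * a) * C :=
          mul_nonneg (add_nonneg zero_le_one (mul_nonneg (by linarith) ha)) hC0
        have hmonoH : (1 + (1 + ε) * a) * C * Hp (β + 1) * T ≤ (1 + (1 + ε) * a) * C * Hp s * T :=
          mul_le_mul_of_nonneg_right (mul_le_mul_of_nonneg_left hHs hpos1) hT0.le
        linarith

/-! ### Small levels `y < y₀` -/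

/-- **The inductive bound at small levels** (compactness): for `y < y₀` both parities satisfy the bound
with any amplitude `≥ 1` once `C` is large, because the whole boundary series is at most
`V(P(z))^{−1} ≤ M₁` (`log z < log y₀/(β − 1)`) and `V(P(z)) ≥ M₁^{−1}`, while the main factor
`V s^{−κ} H(s) (log y)^{−e}` is bounded below (`s ≤ √(log y) ≤ √(log y₀)`). [folklore] -/
theorem small_level {L e : ℝ} {g : ArithmeticFunction ℝ} (hκ : 0 < κ) (hβ : 1 < β) (hL : 0 ≤ L) (he0 : 0 ≤ e)
    (hg : g.IsMultiplicative) (hdim : HasIwaniecDimension g κ L) {H : ℝ → ℝ} (hHpos : ∀ s, 0 < H s)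
    (hHanti : Antitone H) {y₀ C : ℝ} (hC0 : 0 ≤ C)
    (hC : ((Real.log y₀ / ((β - 1) * Real.log 2)) ^ κ * (1 + L / Real.log 2)) ^ 2 *
      Real.sqrt (Real.log y₀) ^ κ * Real.log y₀ ^ e / H (Real.sqrt (Real.log y₀)) ≤ C)
    {amp : ℝ} (hamp : 1 ≤ amp) (par N : ℕ) {y z : ℝ} (hy : y < y₀) (hz : 2 ≤ z) (hzy : z ^ (β - 1) < y)
    (hsz : Real.sqrt (Real.log y) ≤ Real.log z) :
    discT par g β y (primesProdBelow z) N ≤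
      vprod g (primesProdBelow z) * (Real.log y / Real.log z) ^ (-κ) *
        (contT par κ β N (Real.log y / Real.log z) + amp * C * H (Real.log y / Real.log z) * Real.log y ^ (-e)) := by
  have hz1 : 1 < z := by linarith
  have hz0 : 0 < z := by linarith
  have hlogz : 0 < Real.log z := Real.log_pos hz1
  have hlog2 : 0 < Real.log 2 := Real.log_pos one_lt_two
  have hβ1 : 0 < β - 1 := by linarith
  have hzpow : 1 < z ^ (β - 1) := Real.one_lt_rpow hz1 hβ1
  have hy1 : 1 < y := by linarith
  have hy0 : 0 < y := by linarith
  set ly := Real.log y with hly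
  have hlypos : 0 < ly := Real.log_pos hy1
  have hly₀ : ly < Real.log y₀ := Real.log_lt_log hy0 hy
  have hly₀pos : 0 < Real.log y₀ := by linarith
  set s := ly / Real.log z with hsdef
  have hs0 : 0 < s := div_pos hlypos hlogz
  -- `log z < log y₀ / (β - 1)`
  have hlogz_lt : Real.log z ≤ Real.log y₀ / (β - 1) := by
    rw [le_div_iff₀ hβ1]
    have : (β - 1) * Real.log z < ly := by
      rw [← Real.log_rpow hz0]; exact Real.log_lt_log (by linarith) hzy
    linarith
  set M₁ := (Real.log y₀ / ((β - 1) * Real.log 2)) ^ κ * (1 + L / Real.log 2) with hM₁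
  have hVinv : (vprod g (primesProdBelow z))⁻¹ ≤ M₁ := by
    refine (hdim.inv_vprod_le hz).trans ?_
    have h1 : Real.log z / Real.log 2 ≤ Real.log y₀ / ((β - 1) * Real.log 2) := by
      rw [div_le_div_iff₀ hlog2 (by positivity)]
      calc Real.log z * ((β - 1) * Real.log 2) = (Real.log z * (β - 1)) * Real.log 2 := by ring
        _ ≤ Real.log y₀ * Real.log 2 := by
            refine mul_le_mul_of_nonneg_right ?_ hlog2.le
            rw [← le_div_iff₀ hβ1]; exact hlogz_lt
    exact mul_le_mul_of_nonneg_right (Real.rpow_le_rpow (by positivity) h1 hκ.le) (by positivity)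
  set V := vprod g (primesProdBelow z) with hVdef
  have hV : 0 < V := hdim.vprod_pos z
  have hM₁pos : 0 < M₁ := lt_of_lt_of_le (inv_pos.mpr hV) hVinv
  have hVge : M₁⁻¹ ≤ V := by rwa [inv_le_comm₀ hM₁pos hV]
  -- the crude bound `discT ≤ V⁻¹ ≤ M₁ ≤ M₁² V`
  have h01 : ∀ p ∈ (primesProdBelow z).primeFactors, 0 ≤ g p ∧ g p < 1 := fun p hp =>
    hdim.1 p (Nat.prime_of_mem_primeFactors hp)
  have hD : discT par g β y (primesProdBelow z) N ≤ M₁ ^ 2 * V := by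
    calc discT par g β y (primesProdBelow z) N ≤ V⁻¹ :=
          discT_le_inv_vprod hg (squarefree_primesProdBelow z) h01 par β y N
      _ ≤ M₁ := hVinv
      _ = M₁ ^ 2 * M₁⁻¹ := by field_simp
      _ ≤ M₁ ^ 2 * V := mul_le_mul_of_nonneg_left hVge (by positivity)
  -- the lower bound for the main factor
  set sm := Real.sqrt (Real.log y₀) with hsm
  have hsm0 : 0 < sm := Real.sqrt_pos.mpr hly₀pos
  have hss : s ≤ Real.sqrt ly := by
    rw [hsdef, div_le_iff₀ hlogz]
    calc ly = Real.sqrt ly * Real.sqrt ly := (Real.mul_self_sqrt hlypos.le).symm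
      _ ≤ Real.sqrt ly * Real.log z := mul_le_mul_of_nonneg_left hsz (Real.sqrt_nonneg _)
  have hssm : s ≤ sm := hss.trans (Real.sqrt_le_sqrt hly₀.le)
  have h1 : sm ^ (-κ) ≤ s ^ (-κ) := Real.rpow_le_rpow_of_nonpos hs0 hssm (by linarith)
  have h2 : H sm ≤ H s := hHanti hssm
  have h3 : Real.log y₀ ^ (-e) ≤ ly ^ (-e) := Real.rpow_le_rpow_of_nonpos hlypos hly₀.le (by linarith)
  have hcT0 : 0 ≤ contT par κ β N s := contT_nonneg hκ.le hβ.le par N hs0.le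
  have hHsm := hHpos sm
  -- `M₁² ≤ sm^{-κ} C H(sm) (log y₀)^{-e}` from `hC`
  have hkey : M₁ ^ 2 ≤ sm ^ (-κ) * (1 * C * H sm * Real.log y₀ ^ (-e)) := by
    rw [div_le_iff₀ hHsm] at hC
    rw [Real.rpow_neg hsm0.le, Real.rpow_neg hly₀pos.le]
    have hsmκ : 0 < sm ^ κ := Real.rpow_pos_of_pos hsm0 κ
    have hlye : 0 < Real.log y₀ ^ e := Real.rpow_pos_of_pos hly₀pos e
    rw [show (sm ^ κ)⁻¹ * (1 * C * H sm * (Real.log y₀ ^ e)⁻¹) = C * H sm / (sm ^ κ * Real.log y₀ ^ e) by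
      field_simp]
    rw [le_div_iff₀ (mul_pos hsmκ hlye)]
    nlinarith [hC]
  calc discT par g β y (primesProdBelow z) N ≤ M₁ ^ 2 * V := hD
    _ ≤ sm ^ (-κ) * (1 * C * H sm * Real.log y₀ ^ (-e)) * V := mul_le_mul_of_nonneg_right hkey hV.le
    _ ≤ s ^ (-κ) * (amp * C * H s * ly ^ (-e)) * V := by
        refine mul_le_mul_of_nonneg_right (mul_le_mul h1 ?_ (by positivity) (Real.rpow_nonneg hs0.le _)) hV.le
        have := hHpos s
        refine mul_le_mul (mul_le_mul (mul_le_mul_of_nonneg_right hamp hC0) h2 hHsm.le (by positivity))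
          h3 (Real.rpow_nonneg hly₀pos.le _) (by positivity)
    _ ≤ V * s ^ (-κ) * (contT par κ β N s + amp * C * H s * ly ^ (-e)) := by
        nlinarith [mul_nonneg (mul_nonneg hV.le (Real.rpow_nonneg hs0.le (-κ))) hcT0]

/-! ### Base cases -/

/-- `∑_{n ≤ 0} T_n = T_0 = 0`. [folklore] -/
theorem discT_zero_right' (par : ℕ) (g : ArithmeticFunction ℝ) (β D z : ℝ) :
    discT par g β D (primesProdBelow z) 0 = 0 := by
  rw [discT, Finset.sum_range_one, bdrySum_zero par g β D (primesProdBelow_ne_zero z)]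

/-- `∑_{n ≤ 1} T⁻_n = 0`. [folklore] -/
theorem discT_zero_one (g : ArithmeticFunction ℝ) (β D z : ℝ) :
    discT 0 g β D (primesProdBelow z) 1 = 0 := by
  rw [discT, Finset.sum_range_succ, Finset.sum_range_one, bdrySum_zero 0 g β D (primesProdBelow_ne_zero z),
    bdrySum_zero_one_eq, add_zero]

/-- `∑_{n ≤ 1} T⁺_n(y, P(z)) = 0` when `z^{β+1} ≤ y` (no prime below `z` has `p^{β+1} ≥ y`). [folklore] -/
theorem discT_one_one_eq_zero {g : ArithmeticFunction ℝ} {y z : ℝ} (hβ : 0 < β + 1) (hzy : z ^ (β + 1) ≤ y) :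
    discT 1 g β y (primesProdBelow z) 1 = 0 := by
  rw [discT, Finset.sum_range_succ, Finset.sum_range_one, bdrySum_zero 1 g β y (primesProdBelow_ne_zero z),
    zero_add, bdrySum_one_eq]
  refine Finset.sum_eq_zero fun p hp => if_neg ?_
  rintro ⟨-, hle⟩
  have hpz : (p : ℝ) < z := Nat.lt_ceil.mp (Nat.lt_of_mem_primesBelow hp)
  have hp0 : (0 : ℝ) ≤ p := Nat.cast_nonneg p
  have : (p : ℝ) ^ (β + 1) < z ^ (β + 1) := Real.rpow_lt_rpow hp0 hpz hβ
  linarith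

/-! ### Amplitudes and the induction -/

/-- Monotonicity of the inductive bound in the amplitude. [folklore] -/
theorem bound_mono {V sk t a₁ a₂ C H T : ℝ} (hV : 0 ≤ V) (hs : 0 ≤ sk) (hC : 0 ≤ C) (hH : 0 ≤ H)
    (hT : 0 ≤ T) (h12 : a₁ ≤ a₂) {x : ℝ} (hx : x ≤ V * sk * (t + a₁ * C * H * T)) :
    x ≤ V * sk * (t + a₂ * C * H * T) := by
  refine hx.trans (mul_le_mul_of_nonneg_left ?_ (mul_nonneg hV hs))
  have : a₁ * C * H * T ≤ a₂ * C * H * T :=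
    mul_le_mul_of_nonneg_right (mul_le_mul_of_nonneg_right (mul_le_mul_of_nonneg_right h12 hC) hH) hT
  linarith

/-- The amplitudes `A_N = 4N(1 + ε)^{2N}` of the induction: `A_{N+2} ≥ 1`, `A_{N+1} ≥ 0`,
`2 + (1 + ε) A_{N+1} ≤ A_{N+2}` and `1 + (1 + ε)(2 + (1 + ε) A_{N+1}) ≤ A_{N+2}` (`0 ≤ ε ≤ 1/2`). [folklore] -/
theorem amp_facts {ε : ℝ} (hε0 : 0 ≤ ε) (hε1 : ε ≤ 1 / 2) (N : ℕ) :
    0 ≤ 4 * ((N + 1 : ℕ) : ℝ) * (1 + ε) ^ (2 * (N + 1)) ∧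
      1 ≤ 4 * ((N + 2 : ℕ) : ℝ) * (1 + ε) ^ (2 * (N + 2)) ∧
      2 + (1 + ε) * (4 * ((N + 1 : ℕ) : ℝ) * (1 + ε) ^ (2 * (N + 1))) ≤
        4 * ((N + 2 : ℕ) : ℝ) * (1 + ε) ^ (2 * (N + 2)) ∧
      1 + (1 + ε) * (2 + (1 + ε) * (4 * ((N + 1 : ℕ) : ℝ) * (1 + ε) ^ (2 * (N + 1)))) ≤
        4 * ((N + 2 : ℕ) : ℝ) * (1 + ε) ^ (2 * (N + 2)) := by
  have h1 : (1:ℝ) ≤ 1 + ε := by linarith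
  have hp : ∀ k : ℕ, (1:ℝ) ≤ (1 + ε) ^ k := fun k => one_le_pow₀ h1
  have hN0 : (0:ℝ) ≤ N := Nat.cast_nonneg N
  have e1 : (((N + 1 : ℕ) : ℝ)) = N + 1 := by push_cast; ring
  have e2 : (((N + 2 : ℕ) : ℝ)) = N + 2 := by push_cast; ring
  rw [e1, e2]
  have hpow : (1 + ε) ^ (2 * (N + 2)) = (1 + ε) ^ 2 * (1 + ε) ^ (2 * (N + 1)) := by
    rw [← pow_add]; ring_nf
  set P := (1 + ε) ^ (2 * (N + 1)) with hP
  have hP1 : 1 ≤ P := hp _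
  have hq : (1 + ε) ^ (2 * (N + 2)) = (1 + ε) ^ 2 * P := hpow
  rw [hq]
  have hsq : 1 ≤ (1 + ε) ^ 2 := hp 2
  have hsq' : (1 + ε) ^ 2 ≤ 9 / 4 := by nlinarith
  refine ⟨by positivity, ?_, ?_, ?_⟩
  · nlinarith [mul_le_mul hsq hP1 zero_le_one (by positivity)]
  · nlinarith [mul_le_mul hsq hP1 zero_le_one (by positivity), mul_nonneg hN0 (by positivity : (0:ℝ) ≤ (1 + ε) ^ 2 * P)]
  · nlinarith [mul_le_mul hsq hP1 zero_le_one (by positivity), mul_nonneg hN0 (by positivity : (0:ℝ) ≤ (1 + ε) ^ 2 * P)]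

/-- **The induction on the number of boundary terms** (Iwaniec, Lemma 20: (8.1) by induction on `R`,
here with the amplitudes `A_N = 4N(1 + ε)^{2N}`): under the hypotheses of the step theorems, for every `N`
both parities satisfy the inductive bound at all levels. [cite: IwaniecActaArith1980, Lemma 20] -/
theorem claims_all {L e ε₁ R c₀ : ℝ} {Hp Hm : ℝ → ℝ} {g : ArithmeticFunction ℝ}
    (hκ : 0 < κ) (hβ : 1 < β) (hL : 0 ≤ L) (he0 : 0 ≤ e) (he : e < 1 / 2) (hR : 0 ≤ R) (hc₀ : 0 ≤ c₀)
    (hHpos : ∀ s, 0 < Hp s ∧ 0 < Hm s) (hHp_anti : Antitone Hp) (hHm_anti : Antitone Hm)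
    (hHp_cont : Continuous Hp) (hHm_cont : Continuous Hm)
    (hH1 : ∀ s U : ℝ, β ≤ s → s ≤ U →
      ∫ t in s..U, sieveKernel κ t * (1 - 1 / t) ^ (-e) * Hp (t - 1) ≤ (1 + ε₁) * Hm s)
    (hH2 : ∀ s U : ℝ, β + 1 ≤ s → s ≤ U →
      ∫ t in s..U, sieveKernel κ t * (1 - 1 / t) ^ (-e) * Hm (t - 1) ≤ (1 + ε₁) * Hp s)
    (hH3p : ∀ s, β ≤ s → Hp (s - 1) ≤ R * Hm s) (hH3m : ∀ s, β + 1 ≤ s → Hm (s - 1) ≤ R * Hp s)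
    (hH4 : ∀ (N : ℕ) (u : ℝ), (β ≤ u → contT 0 κ β N u ≤ c₀ * Hm u) ∧ (β - 1 ≤ u → contT 1 κ β N u ≤ c₀ * Hp u))
    (hH6 : ∀ s, Real.exp (-s) ≤ Hp s ∧ Real.exp (-s) ≤ Hm s)
    (hg : g.IsMultiplicative) (hdim : HasIwaniecDimension g κ L)
    {Ccr yc : ℝ} (hCcr : 0 ≤ Ccr)
    (hcrude : ∀ y : ℝ, yc ≤ y → ∀ (par N : ℕ),
      discT par g β y (primesProdBelow (Real.exp (Real.sqrt (Real.log y)))) N ≤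
        Ccr * vprod g (primesProdBelow (Real.exp (Real.sqrt (Real.log y)))) *
          Real.sqrt (Real.log y) ^ (-κ) * Real.exp (-Real.sqrt (Real.log y)) * Real.log y ^ (-e))
    {C ε y₀ : ℝ} (hC1 : 1 ≤ C) (hC2 : Ccr * (1 + L) ≤ C) (hy₀c : yc ≤ y₀) (hy₀4 : Real.exp 4 ≤ y₀)
    (hy₀b : (κ + 1) * L * (1 - 1 / β) ^ (-κ - e) * R * c₀ * Real.log y₀ ^ (e - 1 / 2) ≤ 1)
    (hε : ε₁ + (κ + 1) * L * (1 - 1 / β) ^ (-κ - e) * R * Real.log y₀ ^ (-(1 / 2 : ℝ)) ≤ ε)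
    (hε0 : 0 ≤ ε) (hε1 : ε ≤ 1 / 2) (hy₀5 : (β + 1) ^ 2 ≤ Real.log y₀)
    (hy₀6 : L * (β + 1) ^ (κ + 1) * Real.log y₀ ^ (e - 1) ≤ Hp (β + 1) / 2)
    (hy₀7 : L * (β + 1) * c₀ * Real.log y₀ ^ (e - 1) ≤ 1 / 2)
    (hε4 : L * (β + 1) / Real.log y₀ ≤ ε)
    (hCp : ((Real.log y₀ / ((β - 1) * Real.log 2)) ^ κ * (1 + L / Real.log 2)) ^ 2 *
      Real.sqrt (Real.log y₀) ^ κ * Real.log y₀ ^ e / Hp (Real.sqrt (Real.log y₀)) ≤ C)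
    (hCm : ((Real.log y₀ / ((β - 1) * Real.log 2)) ^ κ * (1 + L / Real.log 2)) ^ 2 *
      Real.sqrt (Real.log y₀) ^ κ * Real.log y₀ ^ e / Hm (Real.sqrt (Real.log y₀)) ≤ C) (N : ℕ) :
    (∀ y z : ℝ, 2 ≤ z → z ^ β < y → Real.sqrt (Real.log y) ≤ Real.log z →
      discT 0 g β y (primesProdBelow z) N ≤
        vprod g (primesProdBelow z) * (Real.log y / Real.log z) ^ (-κ) *
          (contT 0 κ β N (Real.log y / Real.log z) +
            (4 * (N : ℝ) * (1 + ε) ^ (2 * N)) * C * Hm (Real.log y / Real.log z) * Real.log y ^ (-e))) ∧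
    (∀ y z : ℝ, 2 ≤ z → z ^ (β - 1) < y → Real.sqrt (Real.log y) ≤ Real.log z →
      discT 1 g β y (primesProdBelow z) N ≤
        vprod g (primesProdBelow z) * (Real.log y / Real.log z) ^ (-κ) *
          (contT 1 κ β N (Real.log y / Real.log z) +
            (4 * (N : ℝ) * (1 + ε) ^ (2 * N)) * C * Hp (Real.log y / Real.log z) * Real.log y ^ (-e))) := by
  have hC0 : (0:ℝ) ≤ C := le_trans zero_le_one hC1
  have hβ0 : 0 < β := by linarith
  have hβ1 : 0 < β + 1 := by linarith
  -- general facts at an admissible level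
  have hfacts : ∀ {y z : ℝ}, 2 ≤ z → z ^ (β - 1) < y →
      1 < y ∧ 0 < Real.log y / Real.log z ∧ 0 ≤ vprod g (primesProdBelow z) := by
    intro y z hz hzy
    have hz1 : 1 < z := by linarith
    have hy1 : 1 < y := lt_trans (Real.one_lt_rpow hz1 (by linarith)) hzy
    exact ⟨hy1, div_pos (Real.log_pos hy1) (Real.log_pos hz1), (hdim.vprod_pos z).le⟩
  have hweak : ∀ {y z : ℝ}, 2 ≤ z → z ^ β < y → z ^ (β - 1) < y := by
    intro y z hz hzy
    have : z ^ (β - 1) ≤ z ^ β := Real.rpow_le_rpow_of_exponent_le (by linarith) (by linarith)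
    linarith
  -- the small-level cases
  have hsmall0 : ∀ {y z : ℝ} {amp : ℝ} (N : ℕ), 1 ≤ amp → y < y₀ → 2 ≤ z → z ^ β < y →
      Real.sqrt (Real.log y) ≤ Real.log z →
      discT 0 g β y (primesProdBelow z) N ≤
        vprod g (primesProdBelow z) * (Real.log y / Real.log z) ^ (-κ) *
          (contT 0 κ β N (Real.log y / Real.log z) + amp * C * Hm (Real.log y / Real.log z) * Real.log y ^ (-e)) :=
    fun N hamp hy hz hzy hsz => small_level hκ hβ hL he0 hg hdim (fun s => (hHpos s).2) hHm_anti hC0 hCm hamp 0 N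
      hy hz (hweak hz hzy) hsz
  have hsmall1 : ∀ {y z : ℝ} {amp : ℝ} (N : ℕ), 1 ≤ amp → y < y₀ → 2 ≤ z → z ^ (β - 1) < y →
      Real.sqrt (Real.log y) ≤ Real.log z →
      discT 1 g β y (primesProdBelow z) N ≤
        vprod g (primesProdBelow z) * (Real.log y / Real.log z) ^ (-κ) *
          (contT 1 κ β N (Real.log y / Real.log z) + amp * C * Hp (Real.log y / Real.log z) * Real.log y ^ (-e)) :=
    fun N hamp hy hz hzy hsz => small_level hκ hβ hL he0 hg hdim (fun s => (hHpos s).1) hHp_anti hC0 hCp hamp 1 N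
      hy hz hzy hsz
  -- nonnegativity of the right-hand side
  have hRHS : ∀ (par N : ℕ) {y z amp : ℝ} (H : ℝ → ℝ), (∀ s, 0 < H s) → 2 ≤ z → z ^ (β - 1) < y → 0 ≤ amp →
      0 ≤ vprod g (primesProdBelow z) * (Real.log y / Real.log z) ^ (-κ) *
        (contT par κ β N (Real.log y / Real.log z) + amp * C * H (Real.log y / Real.log z) * Real.log y ^ (-e)) := by
    intro par N y z amp H hH hz hzy hamp
    obtain ⟨hy1, hs0, hV0⟩ := hfacts hz hzy
    have := contT_nonneg hκ.le hβ.le par N hs0.le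
    have := (hH (Real.log y / Real.log z)).le
    have := Real.rpow_nonneg (Real.log_pos hy1).le (-e)
    have := Real.rpow_nonneg hs0.le (-κ)
    positivity
  -- two-step induction
  suffices H : ∀ N : ℕ,
      ((∀ y z : ℝ, 2 ≤ z → z ^ β < y → Real.sqrt (Real.log y) ≤ Real.log z →
        discT 0 g β y (primesProdBelow z) N ≤
          vprod g (primesProdBelow z) * (Real.log y / Real.log z) ^ (-κ) *
            (contT 0 κ β N (Real.log y / Real.log z) +
              (4 * (N : ℝ) * (1 + ε) ^ (2 * N)) * C * Hm (Real.log y / Real.log z) * Real.log y ^ (-e))) ∧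
      (∀ y z : ℝ, 2 ≤ z → z ^ (β - 1) < y → Real.sqrt (Real.log y) ≤ Real.log z →
        discT 1 g β y (primesProdBelow z) N ≤
          vprod g (primesProdBelow z) * (Real.log y / Real.log z) ^ (-κ) *
            (contT 1 κ β N (Real.log y / Real.log z) +
              (4 * (N : ℝ) * (1 + ε) ^ (2 * N)) * C * Hp (Real.log y / Real.log z) * Real.log y ^ (-e)))) ∧
      ((∀ y z : ℝ, 2 ≤ z → z ^ β < y → Real.sqrt (Real.log y) ≤ Real.log z →
        discT 0 g β y (primesProdBelow z) (N + 1) ≤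
          vprod g (primesProdBelow z) * (Real.log y / Real.log z) ^ (-κ) *
            (contT 0 κ β (N + 1) (Real.log y / Real.log z) +
              (4 * ((N + 1 : ℕ) : ℝ) * (1 + ε) ^ (2 * (N + 1))) * C * Hm (Real.log y / Real.log z) * Real.log y ^ (-e))) ∧
      (∀ y z : ℝ, 2 ≤ z → z ^ (β - 1) < y → Real.sqrt (Real.log y) ≤ Real.log z →
        discT 1 g β y (primesProdBelow z) (N + 1) ≤
          vprod g (primesProdBelow z) * (Real.log y / Real.log z) ^ (-κ) *
            (contT 1 κ β (N + 1) (Real.log y / Real.log z) +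
              (4 * ((N + 1 : ℕ) : ℝ) * (1 + ε) ^ (2 * (N + 1))) * C * Hp (Real.log y / Real.log z) * Real.log y ^ (-e)))) by
    exact (H N).1
  intro N
  induction N with
  | zero =>
    refine ⟨⟨fun y z hz hzy hsz => ?_, fun y z hz hzy hsz => ?_⟩, ⟨fun y z hz hzy hsz => ?_, fun y z hz hzy hsz => ?_⟩⟩
    · rw [discT_zero_right']
      exact hRHS 0 0 Hm (fun s => (hHpos s).2) hz (hweak hz hzy) (by norm_num)
    · rw [discT_zero_right']
      exact hRHS 1 0 Hp (fun s => (hHpos s).1) hz hzy (by norm_num)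
    · rw [discT_zero_one]
      exact hRHS 0 1 Hm (fun s => (hHpos s).2) hz (hweak hz hzy) (by positivity)
    · -- `N = 1`, upper parity
      have hamp1 : (1:ℝ) ≤ 4 * ((0 + 1 : ℕ) : ℝ) * (1 + ε) ^ (2 * (0 + 1)) := by
        norm_num; nlinarith
      by_cases hy : y₀ ≤ y
      · by_cases hhi : z ^ (β + 1) ≤ y
        · rw [discT_one_one_eq_zero hβ1 hhi]
          exact hRHS 1 1 Hp (fun s => (hHpos s).1) hz hzy (by positivity)
        · have hlow := step_one_low hκ hβ hL (by linarith) hc₀ (fun s => (hHpos s).1) hHp_anti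
            (fun N u hu => (hH4 N u).2 hu) hg hdim hC1 hε0 hy₀4 hy₀5 hy₀6 hy₀7 hε4 (le_refl (0:ℝ)) (le_refl 1)
            (fun y' z' hy' hz' hzy' _ => by
              rw [discT_one_one_eq_zero hβ1 hzy']
              exact hRHS 1 1 Hp (fun s => (hHpos s).1) hz'
                (lt_of_lt_of_le (Real.rpow_lt_rpow_of_exponent_lt (by linarith) (by linarith)) hzy') le_rfl)
            y z hy hz hzy (lt_of_not_ge hhi)
          obtain ⟨hy1, hs0, hV0⟩ := hfacts hz hzy
          exact bound_mono hV0 (Real.rpow_nonneg hs0.le _) hC0 (hHpos _).1.le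
            (Real.rpow_nonneg (Real.log_pos hy1).le _) (by norm_num at hamp1 ⊢; nlinarith) hlow
      · exact hsmall1 1 hamp1 (lt_of_not_ge hy) hz hzy hsz
  | succ N ih =>
    obtain ⟨-, ih0, ih1⟩ := ih
    obtain ⟨hA0, hA1, hA2, hA3⟩ := amp_facts hε0 hε1 N
    refine ⟨⟨ih0, ih1⟩, fun y z hz hzy hsz => ?_, fun y z hz hzy hsz => ?_⟩
    · -- lower parity at `N + 2`
      rw [show N + 1 + 1 = N + 2 by ring]
      by_cases hy : y₀ ≤ y
      · have h := step_zero hκ hβ hL he0 he hR hc₀ hHpos hHp_anti hHp_cont hH1 hH3p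
          (fun N u hu => (hH4 N u).2 hu) (fun s => (hH6 s).2) hg hdim hCcr hcrude hC1 hC2 hy₀c hy₀4 hy₀b hε
          hA0 ih1 y z hy hz hzy hsz
        obtain ⟨hy1, hs0, hV0⟩ := hfacts hz (hweak hz hzy)
        exact bound_mono hV0 (Real.rpow_nonneg hs0.le _) hC0 (hHpos _).2.le
          (Real.rpow_nonneg (Real.log_pos hy1).le _) hA2 h
      · exact hsmall0 (N + 2) hA1 (lt_of_not_ge hy) hz hzy hsz
    · -- upper parity at `N + 2`
      rw [show N + 1 + 1 = N + 2 by ring]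
      have hhigh : ∀ y z : ℝ, y₀ ≤ y → 2 ≤ z → z ^ (β + 1) ≤ y → Real.sqrt (Real.log y) ≤ Real.log z →
          discT 1 g β y (primesProdBelow z) (N + 2) ≤
            vprod g (primesProdBelow z) * (Real.log y / Real.log z) ^ (-κ) *
              (contT 1 κ β (N + 2) (Real.log y / Real.log z) +
                (2 + (1 + ε) * (4 * ((N + 1 : ℕ) : ℝ) * (1 + ε) ^ (2 * (N + 1)))) * C *
                  Hp (Real.log y / Real.log z) * Real.log y ^ (-e)) :=
        step_one_high hκ hβ hL he0 he hR hc₀ hHpos hHm_anti hHm_cont hH2 hH3m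
          (fun N u hu => (hH4 N u).1 hu) (fun s => (hH6 s).1) hg hdim hCcr hcrude hC1 hC2 hy₀c hy₀4 hy₀b hε
          hA0 ih0
      by_cases hy : y₀ ≤ y
      · obtain ⟨hy1, hs0, hV0⟩ := hfacts hz hzy
        by_cases hhi : z ^ (β + 1) ≤ y
        · exact bound_mono hV0 (Real.rpow_nonneg hs0.le _) hC0 (hHpos _).1.le
            (Real.rpow_nonneg (Real.log_pos hy1).le _) hA2 (hhigh y z hy hz hhi hsz)
        · have hlow := step_one_low hκ hβ hL (by linarith) hc₀ (fun s => (hHpos s).1) hHp_anti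
            (fun N u hu => (hH4 N u).2 hu) hg hdim hC1 hε0 hy₀4 hy₀5 hy₀6 hy₀7 hε4
            (by positivity : (0:ℝ) ≤ 2 + (1 + ε) * (4 * ((N + 1 : ℕ) : ℝ) * (1 + ε) ^ (2 * (N + 1))))
            (by omega : 1 ≤ N + 2) hhigh y z hy hz hzy (lt_of_not_ge hhi)
          exact bound_mono hV0 (Real.rpow_nonneg hs0.le _) hC0 (hHpos _).1.le
            (Real.rpow_nonneg (Real.log_pos hy1).le _) hA3 hlow
      · exact hsmall1 (N + 2) hA1 (lt_of_not_ge hy) hz hzy hsz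

end BetaSieve

end Literature.NumberTheory.Sieve
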